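import Literature.MathematicalPhysics.QuantumLattice.KickedIsingDualUnitaryPoint
import HarnessLib

/-!
# Light-cone correlations of dual-unitary brickwork circuits (Bertini–Kos–Prosen 2019, Properties 1–2)

Honest framing (register row E-36 of the quantum-advantage dequantization ∕ spoofing lane):
instance-level vocabulary for one specific advantage-adjacent claim; no claim about BQP vs BPP.

This file proves the MANY-BODY half of the exact-verifiability theorem behind Fischer et al.'s
91-qubit "exactly verifiable" benchmark (Nature Physics 2026, arXiv:2411.00765), which the tree's
`DualUnitaryGates.lean` and `KickedIsingDualUnitaryPoint.lean` list as NOT formalised: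
Bertini–Kos–Prosen, *Exact Correlation Functions for Dual-Unitary Lattice Models in 1+1
Dimensions*, PRL 123, 210601 (2019), p. 3,

* **Property 1** (eq. (12)): for a dual-unitary gate `U`, the infinite-temperature dynamical
  correlation `d^{-N} tr[a_z 𝕍† b_y 𝕍]` of traceless single-site operators under the brickwork
  circuit vanishes unless `z` sits on the edge of the light cone of `b_y` spreading at speed one
  (one site per layer), and
* **Property 2** (eq. (17)): on that edge it equals `d⁻¹ tr[a M₊^t(b)]`, `t` the number of layers,
  with the single-gate channel `M₊(a) = d⁻¹ tr₁[U†(a ⊗ 𝟙)U]` (eq. (18); the tree's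
  `DualUnitary.mPlus`),

and, as a corollary with the tree's `KickedIsing.iterate_mPlus_gate_selfDual_X`
(`M₊^t(σˣ) = cos(2h)^t σˣ` for the self-dual kicked-Ising gate), **Fischer et al.'s eq. (2)**:
`C_z(t) = 2^{-N} tr[σˣ_z 𝕍† σˣ_y 𝕍] = δ_{z,y+t} [cos 2h]^t` on the open chain of `N` qubits
(`kickedIsing_selfDual_correlation`).

## The printed proof and how it is followed

BKP prove Property 1 diagrammatically (p. 3): (13) "By repeated use of the unitarity property (6)
we can simplify the circuit out of the light-cone spreading at speed 1 from `a^β`"; then, off the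
edge, (14)–(15) "using the unitarity of `Ũ`, i.e. Eq. (7) … (7) can be ‘telescoped’ until the
operator `a^β` is encountered … the central loop represents the trace of `a^β` factoring out.
Using that … `a^β` are traceless, we then conclude that the correlation vanishes"; Property 2:
unitarity collapses the cone onto its edge, a line of `2t` gates, each contributing one `M_±`.
We follow exactly this argument, written algebraically with the **erasure maps**
`E_x = 𝟙_x ⊗ tr_x(·)/d` (a loop on site `x`, `erase`): the diagrammatic moves become
(i) *time-direction unitarity* — a gate outside the support of the evolved operator cancels
(`EdgeState.conj_outside`), a gate not touching the edge commutes with `E_edge`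
(`EdgeState.conj_away`); (ii) *space-direction unitarity with an environment* — for `M` free of
the fresh site `y`, `E_y(U_{xy}† M U_{xy}) = E_x(M)` (`erase_conj_onPair_of_free`, eq. (7)
contracted against an arbitrary operator on the other sites: the telescoping move); (iii) the loop
on a traceless single-site operator vanishes (`erase_onSite_same_of_trace_eq_zero`). The induction
over layers carries the invariant "`B` is supported left of the edge `r` and `E_r(B) = 0`"
(`EdgeState`) — which gives Property 1 by `tr(a_z B) = tr(a_z E_r(B)) = 0` for `z ≠ r` — together
with the edge marginal `β` (`EdgeValue`: `tr(a_r B) = tr((aβ)_r)` for all `a`), updated by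
`β ↦ M₊(β)` at each edge move (`EdgeValue.conj_edge`, the one-gate identity `trace_mul_mPlus`),
which gives Property 2.

## Contents

* Spin-chain vocabulary over configurations `ι → m` (`ChainOp ι m = Matrix (ι → m) (ι → m) ℂ`,
  any finite site set `ι`, any finite local index type `m`, matching the `Matrix (m × m) (m × m) ℂ`
  gates of `DualUnitaryGates`): single-site and two-site embeddings `onSite`, `onPair` with their
  algebra (`onSite_mul`, `onPair_mul`, `onPair_kronecker_one`, unitarity
  `onPair_conjTranspose_mul_self`, …), the erasure `erase` (`erase_eq_sum`, bimodule property
  `erase_mul_of_free(_right)`, `trace_erase`, `erase_onSite_same`, `erase_onPair_snd`), operators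
  free of a site `Free` (= commutant of the site algebra; entrywise criterion `free_of_apply`,
  `Free.apply_eq_zero`, `Free.apply_update`, `Free.commute_onPair`).
* The sideways rule `erase_conj_onPair_of_free` from `U^R (U^R)† = 𝟙` (`DualUnitary.reshuffle`).
* The invariants `EdgeState`, `EdgeValue`, `EdgeData`, their one-gate steps and the readout
  `EdgeData.correlation` — valid for ANY sequence of two-site gates on any finite site set in which
  the edge is only ever paired with fresh sites (so also for BKP's periodic chain of `2L` sites as
  long as the cone does not wrap, `t ≤ L/2`, and for gate-inhomogeneous dual-unitary circuits).
* The open-chain brickwork of Fischer et al. (`bondGate`, `layerBonds`, `layerOp`, `brick`,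
  `evolveBonds`): `edgeData_brick`, **`brickwork_correlation`** (Properties 1–2) and
  **`kickedIsing_selfDual_correlation`** (Fischer eq. (2)).
* (v2) The mirror family `ν = −` ("the procedure for ν = − is analogous"): the second orientation of
  the sideways rule `erase_conj_onPair_of_free_fst` (from `(U^R)† U^R = 𝟙`), `erase_onPair_fst`,
  `trace_mul_mMinus`, the left edge steps `EdgeState/EdgeValue/EdgeData.conj_edge_left`, and on the
  open chain `edgeData_brick_left`, **`brickwork_correlation_left`**: for `b_y` whose first layer
  pairs `(y−1, y)` and `t ≤ y`, `d^{-N} tr[a_z 𝕍† b_y 𝕍] = δ_{z,y−t} · d⁻¹ tr[a M₋^t(b)]`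
  (`DualUnitary.mMinus`, eq. (19)).

## Conventions and what is NOT formalised

Sites are `Fin N` (open chain, as in Fischer et al.; BKP's ring differs only by the wrap-around
bond, irrelevant while `t ≤ L/2`); the moving operator `b_y` is sandwiched as `𝕍† b 𝕍` (BKP
eq. (8), `𝕌^{-t} a^β_y 𝕌^t`) and its first layer pairs `(y, y+1)` — BKP's `ν = +` family
(`2y` odd), Fischer's `n = t` edge read from site `y = 0`; the hypothesis `y + t < N` keeps the edge
on the chain (Fischer: `t ≤ (N-1)/2`). Each layer is one unit of time (Fischer), so BKP's `2t`
(two layers per Floquet period) is our `t`; the `ν = −` family (first layer pairing `(y−1, y)`,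
edge `y − t`, channel `M₋`) is the v2 section. Not formalised: BKP's periodic transfer matrix
`𝕌 = 𝕋U^{⊗L}𝕋†U^{⊗L}` as such and the wrap-around regime `t > L/2`, complete positivity ∕ spectra of `M_±` (SM §2, §5),
the Bell-pair rewriting of `C_n(t)` as a pure-state expectation (Fischer, Setup), anything about
noise, error mitigation or the tensor-network comparison of row E-36.

## References

* [BertiniKosProsen2019] B. Bertini, P. Kos, T. Prosen, *Exact Correlation Functions for
  Dual-Unitary Lattice Models in 1+1 Dimensions*, Phys. Rev. Lett. 123, 210601 (2019),
  arXiv:1904.02140 (held text paper:arxiv-1904.02140, p. 3: eqs. (8)–(19), Properties 1–2 and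
  their proofs; p. 7 SM §1).
* [FischerEtAl2026] L. E. Fischer et al., *Dynamical simulations of many-body quantum chaos on a
  quantum computer*, Nature Physics (2026), doi:10.1038/s41567-025-03144-9, arXiv:2411.00765
  (held text paper:arxiv-2411.00765, p. 3 eqs. (1)–(2) and ‘Setup’, p. 6 Methods ‘Dual unitarity’:
  "Dual-unitary circuits … consist of N qubits (labelled n = 0,1,…,N−1) evolving by a brickwork
  pattern of dual-unitary gates Û_{n,n+1}. The brickwork is an even layer … followed by an odd
  layer … We define our unit of time to be the evolution by single layer").

## Mathlib ∕ tree

Mathlib has no partial trace over a `Pi`-type tensor factorisation and no dual-unitary vocabulary;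
the tree's `SpinSystem`/`SpinPartialTrace` files (`Op Λ q`, `localOp`, `spinPartialTrace`) fix the
local space `Fin q` and carry the C⋆-norm structure of the Lieb–Robinson files, whereas the parent
file `DualUnitaryGates` is stated for gates `Matrix (m × m) (m × m) ℂ` over an arbitrary index type;
the light vocabulary here (`onSite`/`onPair`/`erase`/`Free`, all with bodies and proved API) is the
minimal one matching the parent file. Used from the tree: `DualUnitary.reshuffle`, `IsDualUnitary`,
`isDualUnitary_iff_reshuffle`, `mPlus`, `trace_kronecker_one_mul`, `traceLeft/Right`,
`KickedIsing.gate`, `isDualUnitary_gate_selfDual`, `half_trace_X_mul_iterate_mPlus_gate_selfDual`,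
`Pauli.mat`.
-/

noncomputable section

open Matrix Finset
open scoped Kronecker
open Literature.Computability.QuantumComplexity

namespace Literature.MathematicalPhysics.QuantumLattice

namespace DualUnitary

namespace Chain

variable {ι : Type*} [Fintype ι] [DecidableEq ι] {m : Type*} [Fintype m] [DecidableEq m]

/-- Operators on the chain `⊗_{x ∈ ι} ℂ^m`, as matrices indexed by configurations `ι → m`.
[folklore] -/
abbrev ChainOp (ι m : Type*) := Matrix (ι → m) (ι → m) ℂ

/-! ### Sums over configurations that agree off one or two sites -/

/-- Summing over the configurations that agree with `s` off the site `x` is summing over the value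
at `x`. [folklore] -/
private theorem sum_ite_agree (x : ι) (s : ι → m) (F : (ι → m) → ℂ) :
    (∑ u : ι → m, if (∀ k, k ≠ x → u k = s k) then F u else 0) =
      ∑ c : m, F (Function.update s x c) := by
  classical
  rw [← Finset.sum_filter]
  have hset : (Finset.univ.filter fun u : ι → m => ∀ k, k ≠ x → u k = s k) =
      Finset.univ.image (Function.update s x) := by
    ext u
    simp only [Finset.mem_filter, Finset.mem_univ, true_and, Finset.mem_image]
    constructor
    · intro h
      refine ⟨u x, ?_⟩
      funext k
      by_cases hk : k = x
      · subst hk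
        rw [Function.update_self]
      · rw [Function.update_of_ne hk]
        exact (h k hk).symm
    · rintro ⟨c, rfl⟩ k hk
      rw [Function.update_of_ne hk]
  rw [hset, Finset.sum_image fun c _ c' _ h => Function.update_injective s x h]

/-- Two-site version of `sum_ite_agree`. [folklore] -/
private theorem sum_ite_agree₂ {x y : ι} (hxy : x ≠ y) (s : ι → m) (F : (ι → m) → ℂ) :
    (∑ u : ι → m, if (∀ k, k ≠ x → k ≠ y → u k = s k) then F u else 0) =
      ∑ a : m, ∑ b : m, F (Function.update (Function.update s x a) y b) := by
  classical
  have step : ∀ a : m, (∑ b : m, F (Function.update (Function.update s x a) y b)) =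
      ∑ u : ι → m, if (∀ k, k ≠ y → u k = Function.update s x a k) then F u else 0 :=
    fun a => (sum_ite_agree y (Function.update s x a) F).symm
  simp_rw [step]
  rw [Finset.sum_comm]
  refine Finset.sum_congr rfl fun u _ => ?_
  have key : ∀ a : m, (∀ k, k ≠ y → u k = Function.update s x a k) ↔
      (a = u x ∧ ∀ k, k ≠ x → k ≠ y → u k = s k) := by
    intro a
    constructor
    · intro h
      refine ⟨?_, fun k hkx hky => ?_⟩
      · have hx := h x hxy
        rw [Function.update_self] at hx
        exact hx.symm
      · have hk := h k hky
        rwa [Function.update_of_ne hkx] at hk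
    · rintro ⟨rfl, h⟩ k hky
      by_cases hkx : k = x
      · subst hkx
        rw [Function.update_self]
      · rw [Function.update_of_ne hkx]
        exact h k hkx hky
  simp_rw [key]
  by_cases hP : ∀ k, k ≠ x → k ≠ y → u k = s k
  · rw [if_pos hP, Finset.sum_eq_single (u x)]
    · rw [if_pos ⟨rfl, hP⟩]
    · intro a _ ha
      rw [if_neg fun h => ha h.1]
    · intro h
      exact absurd (Finset.mem_univ _) h
  · rw [if_neg hP]
    symm
    apply Finset.sum_eq_zero
    intro a _
    rw [if_neg]
    exact fun h => hP h.2

/-- Re-indexing a fibre `{u : u x = e}` onto `{v : v x = c}` by `u ↦ update u x c`. [folklore] -/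
private theorem sum_fiber_update (x : ι) (e c : m) (G : (ι → m) → ℂ) :
    (∑ u : ι → m, if u x = e then G (Function.update u x c) else 0) =
      ∑ v : ι → m, if v x = c then G v else 0 := by
  classical
  rw [← Finset.sum_filter, ← Finset.sum_filter]
  refine Finset.sum_bij' (fun u _ => Function.update u x c) (fun v _ => Function.update v x e)
    ?_ ?_ ?_ ?_ ?_
  · intro u _
    simp
  · intro v _
    simp
  · intro u hu
    simp only [Finset.mem_filter, Finset.mem_univ, true_and] at hu
    rw [Function.update_idem, ← hu, Function.update_eq_self]
  · intro v hv
    simp only [Finset.mem_filter, Finset.mem_univ, true_and] at hv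
    rw [Function.update_idem, ← hv, Function.update_eq_self]
  · intro u _
    rfl

/-! ### Single-site and two-site embeddings -/

/-- The single-site operator `a` acting at site `x` (and as the identity elsewhere):
`(a_x)_{s t} = a_{s_x t_x} [s = t off x]`. [cite: BertiniKosProsen2019, eq. (8) (`a_x^α`, "a basis
of the space of local operators at site x")] -/
def onSite (x : ι) (a : Matrix m m ℂ) : ChainOp ι m :=
  Matrix.of fun s t => if (∀ k, k ≠ x → s k = t k) then a (s x) (t x) else 0

/-- The two-site gate `U` acting on the ordered pair of sites `(x, y)`:
`(U_{x,y})_{s t} = U_{(s_x,s_y),(t_x,t_y)} [s = t off {x,y}]` (row = output pair, column = input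
pair, as in `DualUnitary.dualGate`). [cite: BertiniKosProsen2019, eq. (2) (`U^{⊗L}`, the local gate
acting on neighbouring sites)] [cite: FischerEtAl2026, Methods ‘Dual unitarity’ (`Û_{n,n+1}`)] -/
def onPair (x y : ι) (U : Matrix (m × m) (m × m) ℂ) : ChainOp ι m :=
  Matrix.of fun s t => if (∀ k, k ≠ x → k ≠ y → s k = t k) then U (s x, s y) (t x, t y) else 0

omit [Fintype m] in
/-- Entries of `a_x`. [folklore] -/
private theorem onSite_apply (x : ι) (a : Matrix m m ℂ) (s t : ι → m) :
    onSite x a s t = if (∀ k, k ≠ x → s k = t k) then a (s x) (t x) else 0 := rfl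

omit [Fintype m] in
/-- Entries of `U_{xy}`. [folklore] -/
private theorem onPair_apply (x y : ι) (U : Matrix (m × m) (m × m) ℂ) (s t : ι → m) :
    onPair x y U s t =
      if (∀ k, k ≠ x → k ≠ y → s k = t k) then U (s x, s y) (t x, t y) else 0 := rfl

/-- Left multiplication by a single-site operator, entrywise. [cite: ManentiMotta2023, §3.2.15 eqs. (3.91)–(3.92)] -/
theorem onSite_mul_apply (x : ι) (a : Matrix m m ℂ) (M : ChainOp ι m) (s t : ι → m) :
    (onSite x a * M) s t = ∑ c, a (s x) c * M (Function.update s x c) t := by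
  rw [Matrix.mul_apply]
  have h : ∀ u, onSite x a s u * M u t =
      if (∀ k, k ≠ x → u k = s k) then a (s x) (u x) * M u t else 0 := by
    intro u
    rw [onSite_apply]
    by_cases hu : ∀ k, k ≠ x → u k = s k
    · rw [if_pos hu, if_pos fun k hk => (hu k hk).symm]
    · rw [if_neg hu, if_neg fun h' => hu fun k hk => (h' k hk).symm, zero_mul]
  simp_rw [h]
  rw [sum_ite_agree]
  simp only [Function.update_self]

/-- Right multiplication by a single-site operator, entrywise. [cite: ManentiMotta2023, §3.2.15 eqs. (3.91)–(3.92)] -/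
theorem mul_onSite_apply (x : ι) (a : Matrix m m ℂ) (M : ChainOp ι m) (s t : ι → m) :
    (M * onSite x a) s t = ∑ c, M s (Function.update t x c) * a c (t x) := by
  rw [Matrix.mul_apply]
  have h : ∀ u, M s u * onSite x a u t =
      if (∀ k, k ≠ x → u k = t k) then M s u * a (u x) (t x) else 0 := by
    intro u
    rw [onSite_apply]
    split_ifs <;> simp
  simp_rw [h]
  rw [sum_ite_agree]
  simp only [Function.update_self]

/-- Left multiplication by a two-site gate, entrywise. [cite: ManentiMotta2023, §3.2.15 eqs. (3.91)–(3.92)] -/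
theorem onPair_mul_apply {x y : ι} (hxy : x ≠ y) (U : Matrix (m × m) (m × m) ℂ)
    (M : ChainOp ι m) (s t : ι → m) :
    (onPair x y U * M) s t = ∑ a, ∑ b, U (s x, s y) (a, b) *
      M (Function.update (Function.update s x a) y b) t := by
  rw [Matrix.mul_apply]
  have h : ∀ u, onPair x y U s u * M u t =
      if (∀ k, k ≠ x → k ≠ y → u k = s k) then U (s x, s y) (u x, u y) * M u t else 0 := by
    intro u
    rw [onPair_apply]
    by_cases hu : ∀ k, k ≠ x → k ≠ y → u k = s k
    · rw [if_pos hu, if_pos fun k hk hk' => (hu k hk hk').symm]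
    · rw [if_neg hu, if_neg fun h' => hu fun k hk hk' => (h' k hk hk').symm, zero_mul]
  simp_rw [h]
  rw [sum_ite_agree₂ hxy]
  refine Finset.sum_congr rfl fun a _ => Finset.sum_congr rfl fun b _ => ?_
  rw [Function.update_self, Function.update_of_ne hxy, Function.update_self]

/-- Right multiplication by a two-site gate, entrywise. [cite: ManentiMotta2023, §3.2.15 eqs. (3.91)–(3.92)] -/
theorem mul_onPair_apply {x y : ι} (hxy : x ≠ y) (U : Matrix (m × m) (m × m) ℂ)
    (M : ChainOp ι m) (s t : ι → m) :
    (M * onPair x y U) s t = ∑ a, ∑ b, M s (Function.update (Function.update t x a) y b) *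
      U (a, b) (t x, t y) := by
  rw [Matrix.mul_apply]
  have h : ∀ u, M s u * onPair x y U u t =
      if (∀ k, k ≠ x → k ≠ y → u k = t k) then M s u * U (u x, u y) (t x, t y) else 0 := by
    intro u
    rw [onPair_apply]
    split_ifs <;> simp
  simp_rw [h]
  rw [sum_ite_agree₂ hxy]
  refine Finset.sum_congr rfl fun a _ => Finset.sum_congr rfl fun b _ => ?_
  rw [Function.update_self, Function.update_of_ne hxy, Function.update_self]

/-! ### Algebra of the embeddings -/

omit [Fintype ι] [Fintype m] [DecidableEq m] in
/-- Agreement off `x` ignores an update at `x`. [folklore] -/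
private theorem agree_update_iff (x : ι) (s t : ι → m) (c : m) :
    (∀ k, k ≠ x → Function.update s x c k = t k) ↔ (∀ k, k ≠ x → s k = t k) := by
  refine forall_congr' fun k => imp_congr_right fun hk => ?_
  rw [Function.update_of_ne hk]

/-- `a_x b_x = (ab)_x`. [cite: ManentiMotta2023, §3.2.15 eqs. (3.91)–(3.92)] -/
theorem onSite_mul (x : ι) (a b : Matrix m m ℂ) : onSite x a * onSite x b = onSite x (a * b) := by
  ext s t
  rw [onSite_mul_apply]
  simp only [onSite_apply, Function.update_self, agree_update_iff]
  split_ifs with h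
  · rw [Matrix.mul_apply]
  · simp

omit [Fintype m] in
/-- `𝟙_x = 𝟙`. [cite: ManentiMotta2023, §3.2.15 eqs. (3.91)–(3.92)] -/
theorem onSite_one (x : ι) : onSite x (1 : Matrix m m ℂ) = (1 : ChainOp ι m) := by
  ext s t
  rw [onSite_apply, Matrix.one_apply, Matrix.one_apply]
  by_cases h : s = t
  · subst h
    simp
  · rw [if_neg h]
    by_cases h1 : ∀ k, k ≠ x → s k = t k
    · rw [if_pos h1, if_neg]
      intro h2
      apply h
      funext k
      by_cases hk : k = x
      · subst hk
        exact h2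
      · exact h1 k hk
    · rw [if_neg h1]

omit [Fintype m] in
/-- `(a_x)† = (a†)_x`. [cite: ManentiMotta2023, §3.2.15 eqs. (3.91)–(3.92)] -/
theorem onSite_conjTranspose (x : ι) (a : Matrix m m ℂ) : (onSite x a)ᴴ = onSite x aᴴ := by
  ext s t
  rw [Matrix.conjTranspose_apply, onSite_apply, onSite_apply, Matrix.conjTranspose_apply]
  have hiff : (∀ k, k ≠ x → t k = s k) ↔ (∀ k, k ≠ x → s k = t k) :=
    ⟨fun h k hk => (h k hk).symm, fun h k hk => (h k hk).symm⟩
  by_cases h : ∀ k, k ≠ x → s k = t k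
  · rw [if_pos h, if_pos (hiff.mpr h)]
  · rw [if_neg h, if_neg fun h' => h (hiff.mp h'), star_zero]

/-- `U_{xy} V_{xy} = (UV)_{xy}`. [cite: ManentiMotta2023, §3.2.15 eqs. (3.91)–(3.92)] -/
theorem onPair_mul {x y : ι} (hxy : x ≠ y) (U V : Matrix (m × m) (m × m) ℂ) :
    onPair x y U * onPair x y V = onPair x y (U * V) := by
  ext s t
  rw [onPair_mul_apply hxy]
  have hc : ∀ a b : m, (∀ k, k ≠ x → k ≠ y →
      Function.update (Function.update s x a) y b k = t k) ↔ (∀ k, k ≠ x → k ≠ y → s k = t k) := by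
    intro a b
    refine forall_congr' fun k => imp_congr_right fun hkx => imp_congr_right fun hky => ?_
    rw [Function.update_of_ne hky, Function.update_of_ne hkx]
  simp only [onPair_apply, hc, Function.update_self, Function.update_of_ne hxy]
  by_cases h : ∀ k, k ≠ x → k ≠ y → s k = t k
  · simp only [if_pos h, Matrix.mul_apply, Fintype.sum_prod_type]
  · simp only [if_neg h, mul_zero, Finset.sum_const_zero]

omit [Fintype m] in
/-- `𝟙_{xy} = 𝟙`. [cite: ManentiMotta2023, §3.2.15 eqs. (3.91)–(3.92)] -/
theorem onPair_one {x y : ι} (hxy : x ≠ y) : onPair x y (1 : Matrix (m × m) (m × m) ℂ) =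
    (1 : ChainOp ι m) := by
  ext s t
  rw [onPair_apply, Matrix.one_apply, Matrix.one_apply]
  by_cases h : s = t
  · subst h
    simp
  · rw [if_neg h]
    by_cases h1 : ∀ k, k ≠ x → k ≠ y → s k = t k
    · rw [if_pos h1, if_neg]
      intro h2
      rw [Prod.mk.injEq] at h2
      apply h
      funext k
      by_cases hkx : k = x
      · subst hkx; exact h2.1
      · by_cases hky : k = y
        · subst hky; exact h2.2
        · exact h1 k hkx hky
    · rw [if_neg h1]

omit [Fintype m] in
/-- `(U_{xy})† = (U†)_{xy}`. [cite: ManentiMotta2023, §3.2.15 eqs. (3.91)–(3.92)] -/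
theorem onPair_conjTranspose (x y : ι) (U : Matrix (m × m) (m × m) ℂ) :
    (onPair x y U)ᴴ = onPair x y Uᴴ := by
  ext s t
  rw [Matrix.conjTranspose_apply, onPair_apply, onPair_apply, Matrix.conjTranspose_apply]
  have hiff : (∀ k, k ≠ x → k ≠ y → t k = s k) ↔ (∀ k, k ≠ x → k ≠ y → s k = t k) :=
    ⟨fun h k hk hk' => (h k hk hk').symm, fun h k hk hk' => (h k hk hk').symm⟩
  by_cases h : ∀ k, k ≠ x → k ≠ y → s k = t k
  · rw [if_pos h, if_pos (hiff.mpr h)]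
  · rw [if_neg h, if_neg fun h' => h (hiff.mp h'), star_zero]

/-- A unitary gate embeds as a unitary: `U_{xy} U_{xy}† = 𝟙`. [cite: ManentiMotta2023, §3.2.15 eqs. (3.91)–(3.92)] -/
theorem onPair_mul_conjTranspose_self {x y : ι} (hxy : x ≠ y) {U : Matrix (m × m) (m × m) ℂ}
    (hU : U * Uᴴ = 1) : onPair x y U * (onPair x y U)ᴴ = 1 := by
  rw [onPair_conjTranspose, onPair_mul hxy, hU, onPair_one hxy]

/-- … and `U_{xy}† U_{xy} = 𝟙`. [cite: ManentiMotta2023, §3.2.15 eqs. (3.91)–(3.92)] -/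
theorem onPair_conjTranspose_mul_self {x y : ι} (hxy : x ≠ y) {U : Matrix (m × m) (m × m) ℂ}
    (hU : Uᴴ * U = 1) : (onPair x y U)ᴴ * onPair x y U = 1 := by
  rw [onPair_conjTranspose, onPair_mul hxy, hU, onPair_one hxy]

omit [Fintype m] in
/-- `(a ⊗ 𝟙)_{xy} = a_x`. [cite: ManentiMotta2023, §3.2.15 eqs. (3.91)–(3.92)] -/
theorem onPair_kronecker_one {x y : ι} (hxy : x ≠ y) (a : Matrix m m ℂ) :
    onPair x y (a ⊗ₖ (1 : Matrix m m ℂ)) = onSite x a := by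
  ext s t
  rw [onPair_apply, onSite_apply, Matrix.kroneckerMap_apply, Matrix.one_apply]
  by_cases h : ∀ k, k ≠ x → s k = t k
  · rw [if_pos h, if_pos fun k hk _ => h k hk, if_pos (h y hxy.symm), mul_one]
  · rw [if_neg h]
    by_cases h' : ∀ k, k ≠ x → k ≠ y → s k = t k
    · rw [if_pos h', if_neg, mul_zero]
      intro hy
      exact h fun k hk => if hky : k = y then hky ▸ hy else h' k hk hky
    · rw [if_neg h']

omit [Fintype m] in
/-- `(𝟙 ⊗ b)_{xy} = b_y`. [cite: ManentiMotta2023, §3.2.15 eqs. (3.91)–(3.92)] -/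
theorem onPair_one_kronecker {x y : ι} (hxy : x ≠ y) (b : Matrix m m ℂ) :
    onPair x y ((1 : Matrix m m ℂ) ⊗ₖ b) = onSite y b := by
  ext s t
  rw [onPair_apply, onSite_apply, Matrix.kroneckerMap_apply, Matrix.one_apply]
  by_cases h : ∀ k, k ≠ y → s k = t k
  · rw [if_pos h, if_pos fun k _ hk => h k hk, if_pos (h x hxy), one_mul]
  · rw [if_neg h]
    by_cases h' : ∀ k, k ≠ x → k ≠ y → s k = t k
    · rw [if_pos h', if_neg, zero_mul]
      intro hx
      exact h fun k hk => if hkx : k = x then hkx ▸ hx else h' k hkx hk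
    · rw [if_neg h']

/-- Conjugating a single-site operator on the second site by the gate:
`U_{xy} b_y U_{xy}† = (U (𝟙 ⊗ b) U†)_{xy}`. [cite: ManentiMotta2023, §3.2.15 eqs. (3.91)–(3.92)] -/
theorem onPair_mul_onSite_mul_conjTranspose {x y : ι} (hxy : x ≠ y)
    (U : Matrix (m × m) (m × m) ℂ) (b : Matrix m m ℂ) :
    onPair x y U * onSite y b * (onPair x y U)ᴴ =
      onPair x y (U * ((1 : Matrix m m ℂ) ⊗ₖ b) * Uᴴ) := by
  rw [← onPair_one_kronecker hxy, onPair_mul hxy, onPair_conjTranspose, onPair_mul hxy]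

/-! ### Erasing a site (normalised partial trace, re-embedded) and operators free of a site -/

/-- **Erasure of site `x`**: `E_x(M) = 𝟙_x ⊗ tr_x(M) / d`, the normalised partial trace over
site `x` tensored back with the identity — entrywise
`E_x(M)_{s t} = [s_x = t_x] d⁻¹ Σ_c M_{s[x↦c], t[x↦c]}`. In the diagrammatic language this is the
contraction of the two legs at site `x` into a loop (weight `1/d`).
[cite: BertiniKosProsen2019, eqs. (13)–(16) (the loops "giving tr[a]" that "factor out")] -/
def erase (x : ι) (M : ChainOp ι m) : ChainOp ι m :=
  Matrix.of fun s t => if s x = t x then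
    ((Fintype.card m : ℂ))⁻¹ * ∑ c, M (Function.update s x c) (Function.update t x c) else 0

omit [Fintype ι] in
/-- Entries of `E_x(M)`. [folklore] -/
private theorem erase_apply (x : ι) (M : ChainOp ι m) (s t : ι → m) :
    erase x M s t = if s x = t x then
      ((Fintype.card m : ℂ))⁻¹ * ∑ c, M (Function.update s x c) (Function.update t x c) else 0 :=
  rfl

/-- **`M` is free of site `x`** (acts as the identity there, `M ∈ 𝟙_x ⊗ End(rest)`): it commutes
with every single-site operator at `x`. [cite: ManentiMotta2023, §3.2.15 eqs. (3.91)–(3.92)] -/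
def Free (x : ι) (M : ChainOp ι m) : Prop :=
  ∀ a : Matrix m m ℂ, Commute (onSite x a) M

/-- Left multiplication by a matrix unit at `x`. [folklore] -/
private theorem single_onSite_mul_apply (x : ι) (p q : m) (M : ChainOp ι m) (s t : ι → m) :
    (onSite x (Matrix.single p q (1 : ℂ)) * M) s t =
      if s x = p then M (Function.update s x q) t else 0 := by
  rw [onSite_mul_apply]
  by_cases hp : s x = p
  · rw [if_pos hp, Finset.sum_eq_single q]
    · rw [Matrix.single_apply, if_pos ⟨hp.symm, rfl⟩, one_mul]
    · intro c _ hc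
      rw [Matrix.single_apply, if_neg (fun h => hc h.2.symm), zero_mul]
    · intro h
      exact absurd (Finset.mem_univ _) h
  · rw [if_neg hp]
    apply Finset.sum_eq_zero
    intro c _
    rw [Matrix.single_apply, if_neg (fun h => hp h.1.symm), zero_mul]

/-- Right multiplication by a matrix unit at `x`. [folklore] -/
private theorem mul_single_onSite_apply (x : ι) (p q : m) (M : ChainOp ι m) (s t : ι → m) :
    (M * onSite x (Matrix.single p q (1 : ℂ))) s t =
      if t x = q then M s (Function.update t x p) else 0 := by
  rw [mul_onSite_apply]
  by_cases hq : t x = q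
  · rw [if_pos hq, Finset.sum_eq_single p]
    · rw [Matrix.single_apply, if_pos ⟨rfl, hq.symm⟩, mul_one]
    · intro c _ hc
      rw [Matrix.single_apply, if_neg (fun h => hc h.1.symm), mul_zero]
    · intro h
      exact absurd (Finset.mem_univ _) h
  · rw [if_neg hq]
    apply Finset.sum_eq_zero
    intro c _
    rw [Matrix.single_apply, if_neg (fun h => hq h.2.symm), mul_zero]

/-- An operator free of `x` has no entries between configurations that differ at `x`. [cite: ManentiMotta2023, §3.2.15 eqs. (3.91)–(3.92)] -/
theorem Free.apply_eq_zero {x : ι} {M : ChainOp ι m} (h : Free x M) {s t : ι → m}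
    (hst : s x ≠ t x) : M s t = 0 := by
  have key := congr_fun (congr_fun (h (Matrix.single (s x) (s x) 1)).eq s) t
  rw [single_onSite_mul_apply, mul_single_onSite_apply, if_pos rfl, Function.update_eq_self,
    if_neg (Ne.symm hst)] at key
  exact key

/-- … and its entries are unchanged when the common value at `x` is changed. [cite: ManentiMotta2023, §3.2.15 eqs. (3.91)–(3.92)] -/
theorem Free.apply_update {x : ι} {M : ChainOp ι m} (h : Free x M) (s t : ι → m)
    (hst : s x = t x) (c : m) :
    M (Function.update s x c) (Function.update t x c) = M s t := by
  have key := congr_fun (congr_fun (h (Matrix.single (s x) c 1)).eq s) (Function.update t x c)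
  rw [single_onSite_mul_apply, mul_single_onSite_apply, if_pos rfl, Function.update_self,
    if_pos rfl, Function.update_idem, hst, Function.update_eq_self] at key
  exact key

/-- Entrywise criterion for being free of `x`. [cite: ManentiMotta2023, §3.2.15 eqs. (3.91)–(3.92)] -/
theorem free_of_apply {x : ι} {M : ChainOp ι m} (h0 : ∀ s t : ι → m, s x ≠ t x → M s t = 0)
    (h1 : ∀ (s t : ι → m) (c : m), s x = t x →
      M (Function.update s x c) (Function.update t x c) = M s t) : Free x M := by
  intro a
  refine Commute.symm ?_
  ext s t
  rw [mul_onSite_apply, onSite_mul_apply]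
  have hL : ∑ c, M s (Function.update t x c) * a c (t x) =
      M s (Function.update t x (s x)) * a (s x) (t x) := by
    apply Finset.sum_eq_single_of_mem (s x) (Finset.mem_univ _)
    intro c _ hc
    rw [h0 _ _ (by rw [Function.update_self]; exact Ne.symm hc), zero_mul]
  have hR : ∑ c, a (s x) c * M (Function.update s x c) t =
      a (s x) (t x) * M (Function.update s x (t x)) t := by
    apply Finset.sum_eq_single_of_mem (t x) (Finset.mem_univ _)
    intro c _ hc
    rw [h0 _ _ (by rw [Function.update_self]; exact hc), mul_zero]
  rw [hL, hR, mul_comm]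
  congr 1
  have h2 := h1 s (Function.update t x (s x)) (t x) (by rw [Function.update_self])
  rw [Function.update_idem, Function.update_eq_self] at h2
  exact h2.symm

/-- Products of operators free of `x` are free of `x`. [cite: ManentiMotta2023, §3.2.15 eqs. (3.91)–(3.92)] -/
theorem Free.mul {x : ι} {A B : ChainOp ι m} (hA : Free x A) (hB : Free x B) : Free x (A * B) :=
  fun a => (hA a).mul_right (hB a)

/-- The identity is free of every site. [cite: ManentiMotta2023, §3.2.15 eqs. (3.91)–(3.92)] -/
theorem free_one (x : ι) : Free x (1 : ChainOp ι m) := fun _ => Commute.one_right _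

/-- Adjoints of operators free of `x` are free of `x`. [cite: ManentiMotta2023, §3.2.15 eqs. (3.91)–(3.92)] -/
theorem Free.conjTranspose {x : ι} {A : ChainOp ι m} (hA : Free x A) : Free x Aᴴ := by
  intro a
  have h := hA aᴴ
  -- (onSite x aᴴ * A)ᴴ = (A * onSite x aᴴ)ᴴ
  have := congr_arg Matrix.conjTranspose h.eq
  rw [Matrix.conjTranspose_mul, Matrix.conjTranspose_mul, onSite_conjTranspose,
    Matrix.conjTranspose_conjTranspose] at this
  exact this.symm

/-- A single-site operator at another site is free of `x`. [cite: ManentiMotta2023, §3.2.15 eqs. (3.91)–(3.92)] -/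
theorem free_onSite {x y : ι} (hxy : x ≠ y) (b : Matrix m m ℂ) : Free x (onSite y b) := by
  refine free_of_apply (fun s t hst => ?_) (fun s t c _ => ?_)
  · rw [onSite_apply, if_neg]
    exact fun h => hst (h x hxy)
  · rw [onSite_apply, onSite_apply, Function.update_of_ne (Ne.symm hxy),
      Function.update_of_ne (Ne.symm hxy)]
    have : (∀ k, k ≠ y → Function.update s x c k = Function.update t x c k) ↔
        (∀ k, k ≠ y → s k = t k) := by
      refine forall_congr' fun k => imp_congr_right fun hk => ?_
      by_cases hkx : k = x
      · subst hkx
        rw [Function.update_self, Function.update_self]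
        exact ⟨fun _ => ‹s k = t k›, fun _ => rfl⟩
      · rw [Function.update_of_ne hkx, Function.update_of_ne hkx]
    by_cases h : ∀ k, k ≠ y → s k = t k
    · rw [if_pos h, if_pos (this.mpr h)]
    · rw [if_neg h, if_neg fun h' => h (this.mp h')]

/-- A gate on two other sites is free of `x`. [cite: ManentiMotta2023, §3.2.15 eqs. (3.91)–(3.92)] -/
theorem free_onPair {x y z : ι} (hzx : z ≠ x) (hzy : z ≠ y) (U : Matrix (m × m) (m × m) ℂ) :
    Free z (onPair x y U) := by
  refine free_of_apply (fun s t hst => ?_) (fun s t c _ => ?_)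
  · rw [onPair_apply, if_neg]
    exact fun h => hst (h z hzx hzy)
  · rw [onPair_apply, onPair_apply, Function.update_of_ne hzx.symm, Function.update_of_ne hzy.symm,
      Function.update_of_ne hzx.symm, Function.update_of_ne hzy.symm]
    have : (∀ k, k ≠ x → k ≠ y → Function.update s z c k = Function.update t z c k) ↔
        (∀ k, k ≠ x → k ≠ y → s k = t k) := by
      refine forall_congr' fun k => imp_congr_right fun hkx => imp_congr_right fun hky => ?_
      by_cases hkz : k = z
      · subst hkz
        rw [Function.update_self, Function.update_self]
        exact ⟨fun _ => ‹s k = t k›, fun _ => rfl⟩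
      · rw [Function.update_of_ne hkz, Function.update_of_ne hkz]
    by_cases h : ∀ k, k ≠ x → k ≠ y → s k = t k
    · rw [if_pos h, if_pos (this.mpr h)]
    · rw [if_neg h, if_neg fun h' => h (this.mp h')]


/-- An operator free of both sites of a gate commutes with the gate (disjoint supports).
[cite: ManentiMotta2023, §3.2.15 eqs. (3.91)–(3.92)] -/
theorem Free.commute_onPair {x y : ι} (hxy : x ≠ y) {B : ChainOp ι m} (hx : Free x B)
    (hy : Free y B) (U : Matrix (m × m) (m × m) ℂ) : Commute (onPair x y U) B := by
  refine Commute.symm ?_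
  ext s t
  rw [mul_onPair_apply hxy, onPair_mul_apply hxy]
  have hL : ∑ a, ∑ b, B s (Function.update (Function.update t x a) y b) * U (a, b) (t x, t y) =
      B s (Function.update (Function.update t x (s x)) y (s y)) * U (s x, s y) (t x, t y) := by
    rw [Finset.sum_eq_single_of_mem (s x) (Finset.mem_univ _) ?_]
    · rw [Finset.sum_eq_single_of_mem (s y) (Finset.mem_univ _) ?_]
      intro b _ hb
      rw [hy.apply_eq_zero (by rw [Function.update_self]; exact Ne.symm hb), zero_mul]
    · intro a _ ha
      apply Finset.sum_eq_zero
      intro b _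
      rw [hx.apply_eq_zero ?_, zero_mul]
      rw [Function.update_of_ne hxy, Function.update_self]
      exact Ne.symm ha
  have hR : ∑ a, ∑ b, U (s x, s y) (a, b) * B (Function.update (Function.update s x a) y b) t =
      U (s x, s y) (t x, t y) * B (Function.update (Function.update s x (t x)) y (t y)) t := by
    rw [Finset.sum_eq_single_of_mem (t x) (Finset.mem_univ _) ?_]
    · rw [Finset.sum_eq_single_of_mem (t y) (Finset.mem_univ _) ?_]
      intro b _ hb
      rw [hy.apply_eq_zero (by rw [Function.update_self]; exact hb), mul_zero]
    · intro a _ ha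
      apply Finset.sum_eq_zero
      intro b _
      rw [hx.apply_eq_zero ?_, mul_zero]
      rw [Function.update_of_ne hxy, Function.update_self]
      exact ha
  rw [hL, hR, mul_comm]
  congr 1
  have e1 := hx.apply_update s (Function.update (Function.update t x (s x)) y (s y))
    (by rw [Function.update_of_ne hxy, Function.update_self]) (t x)
  rw [Function.update_comm (Ne.symm hxy) (s y) (t x) (Function.update t x (s x)),
    Function.update_idem, Function.update_eq_self] at e1
  have e2 := hy.apply_update (Function.update s x (t x)) (Function.update t y (s y))
    (by rw [Function.update_of_ne (Ne.symm hxy), Function.update_self]) (t y)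
  rw [Function.update_idem, Function.update_eq_self] at e2
  rw [← e1]
  exact e2.symm

/-! ### Properties of the erasure map -/

/-- `E_x(M)` is free of `x`. [cite: ManentiMotta2023, §6.6.1 eqs. (6.49)–(6.51)] -/
theorem free_erase (x : ι) (M : ChainOp ι m) : Free x (erase x M) := by
  refine free_of_apply (fun s t hst => by rw [erase_apply, if_neg hst]) (fun s t c hst => ?_)
  rw [erase_apply, erase_apply, if_pos (by rw [Function.update_self, Function.update_self]),
    if_pos hst]
  simp only [Function.update_idem]

/-- An operator free of `x` is fixed by `E_x`. [cite: ManentiMotta2023, §6.6.1 eqs. (6.49)–(6.51)] -/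
theorem Free.erase_eq [Nonempty m] {x : ι} {A : ChainOp ι m} (h : Free x A) : erase x A = A := by
  ext s t
  rw [erase_apply]
  by_cases hst : s x = t x
  · rw [if_pos hst]
    simp only [h.apply_update s t hst, Finset.sum_const, Finset.card_univ, nsmul_eq_mul]
    rw [← mul_assoc, inv_mul_cancel₀ (Nat.cast_ne_zero.mpr Fintype.card_ne_zero), one_mul]
  · rw [if_neg hst, h.apply_eq_zero hst]

/-- `E_x` as an average over matrix units at `x`:
`E_x(M) = d⁻¹ Σ_{p q} (e_{pq})_x M (e_{qp})_x`. [cite: ManentiMotta2023, §6.6.1 eqs. (6.49)–(6.51)] -/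
theorem erase_eq_sum (x : ι) (M : ChainOp ι m) : erase x M = ((Fintype.card m : ℂ))⁻¹ •
    ∑ p : m, ∑ q : m, onSite x (Matrix.single p q 1) * M * onSite x (Matrix.single q p 1) := by
  ext s t
  rw [erase_apply, Matrix.smul_apply, smul_eq_mul]
  simp only [Matrix.sum_apply]
  have h : ∀ p q : m, (onSite x (Matrix.single p q 1) * M * onSite x (Matrix.single q p 1)) s t =
      if s x = p ∧ t x = p then M (Function.update s x q) (Function.update t x q) else 0 := by
    intro p q
    rw [Matrix.mul_assoc, single_onSite_mul_apply, mul_single_onSite_apply]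
    by_cases hp : s x = p
    · by_cases hq : t x = p
      · rw [if_pos hp, if_pos hq, if_pos ⟨hp, hq⟩]
      · rw [if_pos hp, if_neg hq, if_neg (fun h => hq h.2)]
    · rw [if_neg hp, if_neg (fun h => hp h.1)]
  simp only [h]
  by_cases hst : s x = t x
  · rw [if_pos hst]
    congr 1
    symm
    rw [Finset.sum_eq_single_of_mem (t x) (Finset.mem_univ _)]
    · refine Finset.sum_congr rfl fun q _ => ?_
      rw [if_pos ⟨hst, rfl⟩]
    · intro p _ hp
      apply Finset.sum_eq_zero
      intro q _
      rw [if_neg]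
      exact fun h => hp h.2.symm
  · rw [if_neg hst]
    symm
    rw [mul_eq_zero]
    right
    apply Finset.sum_eq_zero
    intro p _
    apply Finset.sum_eq_zero
    intro q _
    rw [if_neg]
    rintro ⟨h1, h2⟩
    exact hst (h1.trans h2.symm)

/-- **Bimodule property (left)**: `E_x(A M) = A E_x(M)` for `A` free of `x`. [cite: ManentiMotta2023, §6.6.1 eqs. (6.49)–(6.51)] -/
theorem erase_mul_of_free {x : ι} {A : ChainOp ι m} (hA : Free x A) (M : ChainOp ι m) :
    erase x (A * M) = A * erase x M := by
  rw [erase_eq_sum, erase_eq_sum, Matrix.mul_smul, Finset.mul_sum]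
  congr 1
  refine Finset.sum_congr rfl fun p _ => ?_
  rw [Finset.mul_sum]
  refine Finset.sum_congr rfl fun q _ => ?_
  rw [← Matrix.mul_assoc (onSite x _) A M, (hA _).eq]
  simp only [Matrix.mul_assoc]

/-- **Bimodule property (right)**: `E_x(M A) = E_x(M) A` for `A` free of `x`. [cite: ManentiMotta2023, §6.6.1 eqs. (6.49)–(6.51)] -/
theorem erase_mul_of_free_right {x : ι} {A : ChainOp ι m} (hA : Free x A) (M : ChainOp ι m) :
    erase x (M * A) = erase x M * A := by
  rw [erase_eq_sum, erase_eq_sum, Matrix.smul_mul, Finset.sum_mul]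
  congr 1
  refine Finset.sum_congr rfl fun p _ => ?_
  rw [Finset.sum_mul]
  refine Finset.sum_congr rfl fun q _ => ?_
  simp only [Matrix.mul_assoc]
  rw [(hA (Matrix.single q p 1)).eq]

/-- `E_x` preserves the trace. [cite: ManentiMotta2023, §6.6.1 eqs. (6.49)–(6.51)] -/
theorem trace_erase [Nonempty m] (x : ι) (M : ChainOp ι m) : (erase x M).trace = M.trace := by
  simp only [Matrix.trace, Matrix.diag, erase_apply, if_true]
  rw [← Finset.mul_sum, Finset.sum_comm]
  have hc : ∀ c : m, ∑ s : ι → m, M (Function.update s x c) (Function.update s x c) =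
      (Fintype.card m : ℂ) * ∑ v : ι → m, if v x = c then M v v else 0 := by
    intro c
    calc ∑ s : ι → m, M (Function.update s x c) (Function.update s x c)
        = ∑ s : ι → m, ∑ e : m, if s x = e then
            M (Function.update s x c) (Function.update s x c) else 0 :=
          Finset.sum_congr rfl fun s _ => by rw [Finset.sum_ite_eq, if_pos (Finset.mem_univ _)]
      _ = ∑ e : m, ∑ s : ι → m, if s x = e then
            M (Function.update s x c) (Function.update s x c) else 0 := Finset.sum_comm
      _ = ∑ e : m, ∑ v : ι → m, if v x = c then M v v else 0 :=
          Finset.sum_congr rfl fun e _ => sum_fiber_update x e c (fun v => M v v)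
      _ = (Fintype.card m : ℂ) * ∑ v : ι → m, if v x = c then M v v else 0 := by
          rw [Finset.sum_const, Finset.card_univ, nsmul_eq_mul]
  simp_rw [hc]
  rw [← Finset.mul_sum, ← mul_assoc, inv_mul_cancel₀ (Nat.cast_ne_zero.mpr Fintype.card_ne_zero),
    one_mul, Finset.sum_comm]
  refine Finset.sum_congr rfl fun v _ => ?_
  rw [Finset.sum_ite_eq, if_pos (Finset.mem_univ _)]

omit [Fintype ι] [Fintype m] [DecidableEq m] in
/-- Agreement off `x` ignores updates at `x`. [folklore] -/
private theorem agree_update_update_iff (x : ι) (s t : ι → m) (c c' : m) :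
    (∀ k, k ≠ x → Function.update s x c k = Function.update t x c' k) ↔
      (∀ k, k ≠ x → s k = t k) := by
  refine forall_congr' fun k => imp_congr_right fun hk => ?_
  rw [Function.update_of_ne hk, Function.update_of_ne hk]

/-- `E_x(a_x) = (tr a / d) 𝟙`: a single-site operator is erased to its normalised trace (the
"loop giving tr[a]"). [cite: BertiniKosProsen2019, proof of Property 1, case (ii)/(iii) ("the
loop giving tr[a^α] factors out", "the central loop represents the trace of a^β factoring out")] -/
theorem erase_onSite_same (x : ι) (a : Matrix m m ℂ) :
    erase x (onSite x a) = (((Fintype.card m : ℂ))⁻¹ * a.trace) • (1 : ChainOp ι m) := by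
  ext s t
  rw [erase_apply, Matrix.smul_apply, Matrix.one_apply, smul_eq_mul]
  have hc : ∀ c : m, onSite x a (Function.update s x c) (Function.update t x c) =
      if (∀ k, k ≠ x → s k = t k) then a c c else 0 := by
    intro c
    rw [onSite_apply, Function.update_self, Function.update_self]
    by_cases hA : ∀ k, k ≠ x → s k = t k
    · rw [if_pos hA, if_pos ((agree_update_update_iff x s t c c).mpr hA)]
    · rw [if_neg hA, if_neg (fun h => hA ((agree_update_update_iff x s t c c).mp h))]
  simp only [hc]
  by_cases hA : ∀ k, k ≠ x → s k = t k
  · simp only [if_pos hA]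
    by_cases hst : s x = t x
    · have hseq : s = t :=
        funext fun k => if hk : k = x then (by rw [hk]; exact hst) else hA k hk
      rw [if_pos hst, if_pos hseq, mul_one]
      rfl
    · have hne : s ≠ t := fun h => hst (by rw [h])
      rw [if_neg hst, if_neg hne, mul_zero]
  · simp only [if_neg hA, Finset.sum_const_zero, mul_zero, ite_self]
    have hne : s ≠ t := fun h => hA fun k _ => by rw [h]
    rw [if_neg hne, mul_zero]

/-- … hence `E_x(a_x) = 0` for traceless `a`. [cite: BertiniKosProsen2019, proof of Property 1
("Using that for β ≠ 0 the operators a^β are traceless, we then conclude that the correlation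
vanishes")] -/
theorem erase_onSite_same_of_trace_eq_zero (x : ι) {a : Matrix m m ℂ} (ha : a.trace = 0) :
    erase x (onSite x a) = 0 := by
  rw [erase_onSite_same, ha, mul_zero, zero_smul]

/-- Erasing the second site of a two-site operator leaves its partial trace on the first site:
`E_y(X_{xy}) = d⁻¹ (tr₂ X)_x`. [cite: ManentiMotta2023, §6.6.1 eqs. (6.49)–(6.51)] -/
theorem erase_onPair_snd {x y : ι} (hxy : x ≠ y) (X : Matrix (m × m) (m × m) ℂ) :
    erase y (onPair x y X) = ((Fintype.card m : ℂ))⁻¹ • onSite x (traceRight X) := by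
  ext s t
  rw [erase_apply, Matrix.smul_apply, smul_eq_mul, onSite_apply, traceRight_apply]
  simp only [onPair_apply, Function.update_self, Function.update_of_ne hxy]
  have hc : ∀ c : m, (∀ k, k ≠ x → k ≠ y → Function.update s y c k = Function.update t y c k) ↔
      (∀ k, k ≠ x → k ≠ y → s k = t k) := by
    intro c
    refine forall_congr' fun k => imp_congr_right fun _ => imp_congr_right fun hky => ?_
    rw [Function.update_of_ne hky, Function.update_of_ne hky]
  by_cases hst : s y = t y
  · rw [if_pos hst]
    by_cases hA : ∀ k, k ≠ x → k ≠ y → s k = t k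
    · have hA' : ∀ k, k ≠ x → s k = t k :=
        fun k hk => if hky : k = y then hky ▸ hst else hA k hk hky
      rw [if_pos hA']
      congr 1
      refine Finset.sum_congr rfl fun c _ => ?_
      rw [if_pos ((hc c).mpr hA)]
    · have hA' : ¬ ∀ k, k ≠ x → s k = t k := fun h => hA fun k hk _ => h k hk
      rw [if_neg hA', mul_zero]
      rw [mul_eq_zero]
      right
      exact Finset.sum_eq_zero fun c _ => if_neg fun h => hA ((hc c).mp h)
  · rw [if_neg hst, if_neg (fun h => hst (h y (Ne.symm hxy))), mul_zero]

/-! ### The sideways rule: dual-unitarity as an erasure identity with an arbitrary environment -/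

omit [Fintype ι] [Fintype m] [DecidableEq m] in
/-- Updating `y`, then `x`, then `y` again forgets the first update. [folklore] -/
private theorem update_yxy {x y : ι} (hxy : x ≠ y) (s : ι → m) (c a b : m) :
    Function.update (Function.update (Function.update s y c) x a) y b =
      Function.update (Function.update s x a) y b := by
  rw [Function.update_comm (Ne.symm hxy) c a s, Function.update_idem]

/-- Entries of `U_{xy}† M U_{xy}`. [folklore] -/
private theorem conj_onPair_apply {x y : ι} (hxy : x ≠ y) (U : Matrix (m × m) (m × m) ℂ)
    (M : ChainOp ι m) (S T : ι → m) :
    ((onPair x y U)ᴴ * M * onPair x y U) S T = ∑ a, ∑ b, ∑ a', ∑ b',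
      star (U (a, b) (S x, S y)) * (M (Function.update (Function.update S x a) y b)
        (Function.update (Function.update T x a') y b') * U (a', b') (T x, T y)) := by
  rw [onPair_conjTranspose, Matrix.mul_assoc, onPair_mul_apply hxy]
  refine Finset.sum_congr rfl fun a _ => Finset.sum_congr rfl fun b _ => ?_
  rw [Matrix.conjTranspose_apply, mul_onPair_apply hxy, Finset.mul_sum]
  refine Finset.sum_congr rfl fun a' _ => ?_
  rw [Finset.mul_sum]

/-- The finite sum behind the sideways rule: `Σ_{b,c} U_{(a',b),(p',c)} conj U_{(a,b),(p,c)}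
= (U^R U^R†)_{(a',p'),(a,p)}`. [cite: BertiniKosProsen2019, SM §1 (dual fusion rules)] -/
private theorem sideways_sum {U : Matrix (m × m) (m × m) ℂ} (hU : reshuffle U * (reshuffle U)ᴴ = 1)
    (F : m → m → ℂ) (p p' : m) :
    (∑ c, ∑ a, ∑ b, ∑ a', star (U (a, b) (p, c)) * (F a a' * U (a', b) (p', c))) =
      if p' = p then ∑ a, F a a else 0 := by
  have inner : ∀ a a' : m, (∑ b, ∑ c, star (U (a, b) (p, c)) * U (a', b) (p', c)) =
      (reshuffle U * (reshuffle U)ᴴ) (a', p') (a, p) := by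
    intro a a'
    rw [Matrix.mul_apply, Fintype.sum_prod_type]
    refine Finset.sum_congr rfl fun b _ => Finset.sum_congr rfl fun c _ => ?_
    rw [reshuffle_apply, Matrix.conjTranspose_apply, reshuffle_apply, mul_comm]
  calc (∑ c, ∑ a, ∑ b, ∑ a', star (U (a, b) (p, c)) * (F a a' * U (a', b) (p', c)))
      = ∑ a, ∑ c, ∑ b, ∑ a', star (U (a, b) (p, c)) * (F a a' * U (a', b) (p', c)) :=
        Finset.sum_comm
    _ = ∑ a, ∑ c, ∑ a', ∑ b, star (U (a, b) (p, c)) * (F a a' * U (a', b) (p', c)) :=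
        Finset.sum_congr rfl fun a _ => Finset.sum_congr rfl fun c _ => Finset.sum_comm
    _ = ∑ a, ∑ a', ∑ c, ∑ b, star (U (a, b) (p, c)) * (F a a' * U (a', b) (p', c)) :=
        Finset.sum_congr rfl fun a _ => Finset.sum_comm
    _ = ∑ a, ∑ a', F a a' * ∑ b, ∑ c, star (U (a, b) (p, c)) * U (a', b) (p', c) :=
        Finset.sum_congr rfl fun a _ => Finset.sum_congr rfl fun a' _ => by
          rw [Finset.sum_comm, Finset.mul_sum]
          refine Finset.sum_congr rfl fun b _ => ?_
          rw [Finset.mul_sum]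
          refine Finset.sum_congr rfl fun c _ => ?_
          ring
    _ = ∑ a, ∑ a', F a a' * (reshuffle U * (reshuffle U)ᴴ) (a', p') (a, p) :=
        Finset.sum_congr rfl fun a _ => Finset.sum_congr rfl fun a' _ => by rw [inner]
    _ = if p' = p then ∑ a, F a a else 0 := by
        rw [hU]
        simp only [Matrix.one_apply, Prod.mk.injEq, mul_ite, mul_one, mul_zero]
        by_cases hp : p' = p
        · rw [if_pos hp]
          refine Finset.sum_congr rfl fun a _ => ?_
          rw [Finset.sum_eq_single_of_mem a (Finset.mem_univ _)]
          · rw [if_pos ⟨rfl, hp⟩]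
          · intro a' _ ha'
            exact if_neg fun h => ha' h.1
        · rw [if_neg hp]
          apply Finset.sum_eq_zero
          intro a _
          apply Finset.sum_eq_zero
          intro a' _
          exact if_neg fun h => hp h.2

/-- Freeness at `y` on configurations updated at `x` then `y`. [folklore] -/
private theorem Free.apply_update₂ {x y : ι} (hxy : x ≠ y) {M : ChainOp ι m} (hM : Free y M)
    (s t : ι → m) (hst : s y = t y) (a a' b b' : m) :
    M (Function.update (Function.update s x a) y b)
        (Function.update (Function.update t x a') y b') =
      if b = b' then M (Function.update s x a) (Function.update t x a') else 0 := by
  by_cases hb : b = b'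
  · rw [if_pos hb, hb]
    exact hM.apply_update _ _ (by rw [Function.update_of_ne (Ne.symm hxy),
      Function.update_of_ne (Ne.symm hxy), hst]) b'
  · rw [if_neg hb]
    exact hM.apply_eq_zero (by rw [Function.update_self, Function.update_self]; exact hb)

/-- **The sideways rule (dual-unitarity with an environment).** If `U^R (U^R)† = 𝟙` (the
space-direction unitarity of the gate, `DualUnitary.reshuffle`) and `M` is free of the site `y`,
then erasing `y` after conjugating by the gate on `(x, y)` is the same as erasing `x` before:
`E_y(U_{xy}† M U_{xy}) = E_x(M)`. This is eq. (7) of the source contracted against an arbitrary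
operator on the remaining sites — the move that is "telescoped" along the light-cone edge in the
proof of Property 1. [cite: BertiniKosProsen2019, eq. (7) and eqs. (14)–(15) (proof of
Property 1: "using the unitarity of Ũ … (7) can be ‘telescoped’ until the operator a^β is
encountered")] -/
theorem erase_conj_onPair_of_free {x y : ι} (hxy : x ≠ y) {U : Matrix (m × m) (m × m) ℂ}
    (hU : reshuffle U * (reshuffle U)ᴴ = 1) {M : ChainOp ι m} (hM : Free y M) :
    erase y ((onPair x y U)ᴴ * M * onPair x y U) = erase x M := by
  ext s t
  rw [erase_apply, erase_apply]
  by_cases hst : s y = t y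
  · rw [if_pos hst]
    have hc : ∀ c : m, ((onPair x y U)ᴴ * M * onPair x y U) (Function.update s y c)
        (Function.update t y c) = ∑ a, ∑ b, ∑ a', star (U (a, b) (s x, c)) *
          (M (Function.update s x a) (Function.update t x a') * U (a', b) (t x, c)) := by
      intro c
      rw [conj_onPair_apply hxy]
      simp only [Function.update_self, Function.update_of_ne hxy, update_yxy hxy,
        hM.apply_update₂ hxy s t hst]
      refine Finset.sum_congr rfl fun a _ => Finset.sum_congr rfl fun b _ =>
        Finset.sum_congr rfl fun a' _ => ?_
      simp only [ite_mul, zero_mul, mul_ite, mul_zero, Finset.sum_ite_eq, Finset.mem_univ, if_true]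
    simp only [hc]
    rw [sideways_sum hU (fun a a' => M (Function.update s x a) (Function.update t x a')) (s x) (t x)]
    by_cases hx : s x = t x
    · rw [if_pos hx, if_pos hx.symm]
    · rw [if_neg hx, if_neg (fun h => hx h.symm), mul_zero]
  · rw [if_neg hst]
    by_cases hx : s x = t x
    · rw [if_pos hx]
      symm
      rw [mul_eq_zero]
      right
      exact Finset.sum_eq_zero fun a _ => hM.apply_eq_zero (by
        rw [Function.update_of_ne (Ne.symm hxy), Function.update_of_ne (Ne.symm hxy)]; exact hst)
    · rw [if_neg hx]

/-! ### Unitarity bookkeeping for (dual-)unitary gates -/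

/-- For a dual-unitary gate: `U^R (U^R)† = 𝟙`. [cite: BertiniKosProsen2019, eq. (7)] -/
theorem _root_.Literature.MathematicalPhysics.QuantumLattice.DualUnitary.IsDualUnitary.reshuffle_mul_conjTranspose
    {U : Matrix (m × m) (m × m) ℂ} (hU : IsDualUnitary U) :
    reshuffle U * (reshuffle U)ᴴ = 1 := by
  have h := ((isDualUnitary_iff_reshuffle U).mp hU).2
  have := Matrix.mem_unitaryGroup_iff.mp h
  rwa [Matrix.star_eq_conjTranspose] at this

/-- For a dual-unitary gate: `U U† = 𝟙`. [cite: BertiniKosProsen2019, eq. (6)] -/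
theorem _root_.Literature.MathematicalPhysics.QuantumLattice.DualUnitary.IsDualUnitary.mul_conjTranspose
    {U : Matrix (m × m) (m × m) ℂ} (hU : IsDualUnitary U) : U * Uᴴ = 1 := by
  have := Matrix.mem_unitaryGroup_iff.mp hU.1
  rwa [Matrix.star_eq_conjTranspose] at this

/-- For a dual-unitary gate: `U† U = 𝟙`. [cite: BertiniKosProsen2019, eq. (6)] -/
theorem _root_.Literature.MathematicalPhysics.QuantumLattice.DualUnitary.IsDualUnitary.conjTranspose_mul
    {U : Matrix (m × m) (m × m) ℂ} (hU : IsDualUnitary U) : Uᴴ * U = 1 := by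
  have := Matrix.mem_unitaryGroup_iff'.mp hU.1
  rwa [Matrix.star_eq_conjTranspose] at this

/-! ### Traces against single-site probes -/

/-- `tr(a_x) = (tr a / d) · dim`, where `dim = d^{|ι|}` is the dimension of the chain. [cite: ManentiMotta2023, §6.6.1 eqs. (6.49)–(6.51)] -/
theorem trace_onSite [Nonempty m] (x : ι) (a : Matrix m m ℂ) :
    (onSite x a).trace = ((Fintype.card m : ℂ))⁻¹ * a.trace * (Fintype.card (ι → m) : ℂ) := by
  rw [← trace_erase x (onSite x a), erase_onSite_same, Matrix.trace_smul, Matrix.trace_one,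
    smul_eq_mul]

/-- Probing an operator free of `x` with a single-site operator at `x` only sees its erasure:
`tr(N B) = tr(E_x(N) B)` for `B` free of `x`. [cite: ManentiMotta2023, §6.6.1 eqs. (6.49)–(6.51)] -/
theorem trace_mul_eq_trace_erase_mul [Nonempty m] (x : ι) (N : ChainOp ι m) {B : ChainOp ι m}
    (hB : Free x B) : (N * B).trace = (erase x N * B).trace := by
  rw [← erase_mul_of_free_right hB, trace_erase]

/-- `tr((𝟙 ⊗ a) Y) = tr(a · tr₁ Y)` (defining property of the partial trace over the first
factor). [cite: ManentiMotta2023, §6.6.1 eqs. (6.49)–(6.51)] -/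
theorem trace_one_kronecker_mul (a : Matrix m m ℂ) (Y : Matrix (m × m) (m × m) ℂ) :
    (((1 : Matrix m m ℂ) ⊗ₖ a) * Y).trace = (a * traceLeft Y).trace := by
  simp only [Matrix.trace, Matrix.diag, Matrix.mul_apply, traceLeft_apply,
    Matrix.kroneckerMap_apply, Matrix.one_apply, Fintype.sum_prod_type, ite_mul, one_mul, zero_mul,
    Finset.mul_sum]
  have h : ∀ i j : m, (∑ k, ∑ l, if i = k then a j l * Y (k, l) (i, j) else (0 : ℂ)) =
      ∑ l, a j l * Y (i, l) (i, j) := by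
    intro i j
    rw [Finset.sum_eq_single_of_mem i (Finset.mem_univ _)]
    · exact Finset.sum_congr rfl fun l _ => if_pos rfl
    · intro k _ hk
      exact Finset.sum_eq_zero fun l _ => if_neg (Ne.symm hk)
  simp only [h]
  rw [Finset.sum_comm]
  refine Finset.sum_congr rfl fun j _ => ?_
  rw [Finset.sum_comm]

/-- **The one-gate input of Property 2, as a trace identity**:
`tr(a · M₊(β)) = d⁻¹ tr(tr₂[U (𝟙 ⊗ a) U†] · β)` — moving the gate from the Heisenberg side
(`M₊(β) = d⁻¹ tr₁[U† (β ⊗ 𝟙) U]`) to the probe. [cite: BertiniKosProsen2019, eq. (18)] -/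
theorem trace_mul_mPlus (U : Matrix (m × m) (m × m) ℂ) (a β : Matrix m m ℂ) :
    (a * mPlus U β).trace =
      ((Fintype.card m : ℂ))⁻¹ * (traceRight (U * ((1 : Matrix m m ℂ) ⊗ₖ a) * Uᴴ) * β).trace := by
  unfold mPlus
  rw [Matrix.mul_smul, Matrix.trace_smul, smul_eq_mul]
  congr 1
  rw [← trace_one_kronecker_mul, Matrix.trace_mul_comm (traceRight _) β, ← trace_kronecker_one_mul]
  calc (((1 : Matrix m m ℂ) ⊗ₖ a) * (Uᴴ * (β ⊗ₖ (1 : Matrix m m ℂ)) * U)).trace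
      = (((1 : Matrix m m ℂ) ⊗ₖ a) * Uᴴ * (β ⊗ₖ (1 : Matrix m m ℂ)) * U).trace := by
        simp only [Matrix.mul_assoc]
    _ = (U * (((1 : Matrix m m ℂ) ⊗ₖ a) * Uᴴ * (β ⊗ₖ (1 : Matrix m m ℂ)))).trace :=
        Matrix.trace_mul_comm _ _
    _ = ((U * ((1 : Matrix m m ℂ) ⊗ₖ a) * Uᴴ) * (β ⊗ₖ (1 : Matrix m m ℂ))).trace := by
        simp only [Matrix.mul_assoc]
    _ = ((β ⊗ₖ (1 : Matrix m m ℂ)) * (U * ((1 : Matrix m m ℂ) ⊗ₖ a) * Uᴴ)).trace :=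
        Matrix.trace_mul_comm _ _

/-! ### The light-cone invariant and the one-gate steps -/

/-- **Light-cone bookkeeping.** `B` (the Heisenberg-evolved local operator) is supported inside
`S` — free of every site outside `S` — and *erased at the edge site* `r`: `E_r(B) = 0`, i.e. no
component of `B` acts as the identity at `r`. [cite: BertiniKosProsen2019, eq. (13) (the circuit
reduced to the light cone) and eqs. (14)–(15) (the telescoped edge)] -/
structure EdgeState (S : Finset ι) (r : ι) (B : ChainOp ι m) : Prop where
  free : ∀ z, z ∉ S → Free z B
  erased : erase r B = 0

/-- The support bound may be enlarged. [folklore] -/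
private theorem EdgeState.mono {S S' : Finset ι} (hSS' : S ⊆ S') {r : ι} {B : ChainOp ι m}
    (h : EdgeState S r B) : EdgeState S' r B :=
  ⟨fun z hz => h.free z fun hzS => hz (hSS' hzS), h.erased⟩

/-- Base case: a traceless single-site operator `b_y` is supported in `{y}` and erased at `y`.
[cite: BertiniKosProsen2019, eq. (8) ("all other a^α are traceless")] -/
theorem edgeState_onSite {y : ι} {b : Matrix m m ℂ} (hb : b.trace = 0) :
    EdgeState {y} y (onSite y b) :=
  ⟨fun _ hz => free_onSite (fun h => hz (Finset.mem_singleton.mpr h)) b,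
    erase_onSite_same_of_trace_eq_zero y hb⟩

/-- **Away step.** Conjugating by a gate that does not touch the edge site keeps the invariant
(support grows by the gate's sites; the erasure at `r` commutes with the gate). Unitarity is not
even needed for this step. [cite: BertiniKosProsen2019, eq. (13) (gates inside the light cone)] -/
theorem EdgeState.conj_away {S : Finset ι} {r : ι} {B : ChainOp ι m} (h : EdgeState S r B)
    {p q : ι} (hrp : r ≠ p) (hrq : r ≠ q) (U : Matrix (m × m) (m × m) ℂ) :
    EdgeState (S ∪ {p, q}) r ((onPair p q U)ᴴ * B * onPair p q U) := by
  refine ⟨fun z hz => ?_, ?_⟩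
  · rw [Finset.mem_union, not_or, Finset.mem_insert, Finset.mem_singleton, not_or] at hz
    have hG : Free z (onPair p q U) := free_onPair hz.2.1 hz.2.2 U
    exact (hG.conjTranspose.mul (h.free z hz.1)).mul hG
  · have hG : Free r (onPair p q U) := free_onPair hrp hrq U
    rw [erase_mul_of_free_right hG, erase_mul_of_free hG.conjTranspose, h.erased, Matrix.mul_zero,
      Matrix.zero_mul]

/-- **Outside step.** A unitary gate on two sites outside the support does nothing (strict
causality of the circuit: "we can simplify the circuit out of the light-cone").
[cite: BertiniKosProsen2019, eq. (13) ("By repeated use of the unitarity property (6) we can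
simplify the circuit out of the light-cone spreading at speed 1")] -/
theorem EdgeState.conj_outside {S : Finset ι} {r : ι} {B : ChainOp ι m} (h : EdgeState S r B)
    {p q : ι} (hpq : p ≠ q) (hp : p ∉ S) (hq : q ∉ S) {U : Matrix (m × m) (m × m) ℂ}
    (hU : Uᴴ * U = 1) : (onPair p q U)ᴴ * B * onPair p q U = B := by
  have hc : Commute (onPair p q U) B := Free.commute_onPair hpq (h.free p hp) (h.free q hq) U
  rw [Matrix.mul_assoc, ← hc.eq, ← Matrix.mul_assoc, onPair_conjTranspose_mul_self hpq hU,
    Matrix.one_mul]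

/-- **Edge step.** Conjugating by a space-unitary gate pairing the edge site `r ∈ S` with a fresh
site `q ∉ S` moves the edge to `q`: the new operator is erased at `q` (sideways rule) and supported
in `S ∪ {q}`. [cite: BertiniKosProsen2019, eqs. (14)–(15) (proof of Property 1)] -/
theorem EdgeState.conj_edge {S : Finset ι} {r : ι} {B : ChainOp ι m} (h : EdgeState S r B)
    (hr : r ∈ S) {q : ι} (hrq : r ≠ q) (hq : q ∉ S) {U : Matrix (m × m) (m × m) ℂ}
    (hU : reshuffle U * (reshuffle U)ᴴ = 1) :
    EdgeState (insert q S) q ((onPair r q U)ᴴ * B * onPair r q U) := by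
  refine ⟨fun z hz => ?_, ?_⟩
  · rw [Finset.mem_insert, not_or] at hz
    have hzr : z ≠ r := fun h' => hz.2 (h' ▸ hr)
    have hG : Free z (onPair r q U) := free_onPair hzr hz.1 U
    exact (hG.conjTranspose.mul (h.free z hz.2)).mul hG
  · rw [erase_conj_onPair_of_free hrq hU (h.free q hq), h.erased]

/-- **Property 1 (readout).** An operator erased at `r` has vanishing infinite-temperature
correlation with every single-site probe away from `r`: `tr(a_z B) = 0` for `z ≠ r`.
[cite: BertiniKosProsen2019, Property 1 / eq. (12)] -/
theorem EdgeState.trace_onSite_mul [Nonempty m] {S : Finset ι} {r : ι} {B : ChainOp ι m}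
    (h : EdgeState S r B) {z : ι} (hz : z ≠ r) (a : Matrix m m ℂ) :
    (onSite z a * B).trace = 0 := by
  rw [← trace_erase r (onSite z a * B), erase_mul_of_free (free_onSite (Ne.symm hz) a), h.erased,
    Matrix.mul_zero, Matrix.trace_zero]

/-- **Light-cone value bookkeeping.** Probing `B` at the edge site `r` with any `a` gives the same
trace as probing the single-site operator `β_r` — `β` is the current edge marginal of `B`.
[cite: BertiniKosProsen2019, Property 2 / eq. (17)] -/
def EdgeValue (r : ι) (β : Matrix m m ℂ) (B : ChainOp ι m) : Prop :=
  ∀ a : Matrix m m ℂ, (onSite r a * B).trace = (onSite r (a * β)).trace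

/-- Base case: `β = b` for `B = b_y`. [cite: BertiniKosProsen2019, Property 2 / eq. (17) at t = 0] -/
theorem edgeValue_onSite (y : ι) (b : Matrix m m ℂ) : EdgeValue y b (onSite y b) :=
  fun a => by rw [onSite_mul]

omit [DecidableEq m] in
/-- Moving a conjugation from the operator to the probe under the trace. [folklore] -/
private theorem trace_probe_conj [DecidableEq m] (X G B : ChainOp ι m) :
    (X * (Gᴴ * B * G)).trace = (G * X * Gᴴ * B).trace := by
  rw [← Matrix.mul_assoc, ← Matrix.mul_assoc, Matrix.trace_mul_comm _ G, ← Matrix.mul_assoc,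
    ← Matrix.mul_assoc]

/-- Away / outside steps keep the edge value (unitary gates not touching `r`). [cite: BertiniKosProsen2019, eq. (13)] -/
theorem EdgeValue.conj_away {r : ι} {β : Matrix m m ℂ} {B : ChainOp ι m} (h : EdgeValue r β B)
    {p q : ι} (hpq : p ≠ q) (hrp : r ≠ p) (hrq : r ≠ q) {U : Matrix (m × m) (m × m) ℂ}
    (hU : U * Uᴴ = 1) : EdgeValue r β ((onPair p q U)ᴴ * B * onPair p q U) := by
  intro a
  have hc : Commute (onPair p q U) (onSite r a) := (free_onPair hrp hrq U a).symm
  rw [trace_probe_conj, hc.eq, Matrix.mul_assoc (onSite r a), onPair_mul_conjTranspose_self hpq hU,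
    Matrix.mul_one]
  exact h a

/-- **Edge step for the value (Property 2 engine).** When the dual-unitary gate moves the edge
from `r` to the fresh site `q`, the edge marginal is updated by the light-cone channel:
`β ↦ M₊(β)`. [cite: BertiniKosProsen2019, Property 2 / eqs. (17)–(18) (one factor `M₊` per
layer along the light-cone edge)] -/
theorem EdgeValue.conj_edge [Nonempty m] {S : Finset ι} {r : ι} {β : Matrix m m ℂ}
    {B : ChainOp ι m} (hv : EdgeValue r β B) (hs : EdgeState S r B) {q : ι} (hrq : r ≠ q)
    (hq : q ∉ S) (U : Matrix (m × m) (m × m) ℂ) :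
    EdgeValue q (mPlus U β) ((onPair r q U)ᴴ * B * onPair r q U) := by
  intro a
  have hBq : Free q B := hs.free q hq
  rw [trace_probe_conj, onPair_mul_onSite_mul_conjTranspose hrq,
    trace_mul_eq_trace_erase_mul q _ hBq, erase_onPair_snd hrq, Matrix.smul_mul, Matrix.trace_smul,
    smul_eq_mul, hv, trace_onSite, trace_onSite, trace_mul_mPlus]
  ring

/-- **Property 2 (readout).** At the edge site the correlation is that of the single-site marginal:
`tr(a_r B) = (tr(a β)/d) · dim`. [cite: BertiniKosProsen2019, Property 2 / eq. (17)] -/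
theorem EdgeValue.trace_onSite_mul [Nonempty m] {r : ι} {β : Matrix m m ℂ} {B : ChainOp ι m}
    (h : EdgeValue r β B) (a : Matrix m m ℂ) :
    (onSite r a * B).trace = ((Fintype.card m : ℂ))⁻¹ * (a * β).trace * (Fintype.card (ι → m) : ℂ) := by
  rw [h a, trace_onSite]

/-- The full light-cone data carried along the circuit: support, erasure at the edge, edge value.
[cite: BertiniKosProsen2019, Properties 1–2] -/
structure EdgeData (S : Finset ι) (r : ι) (β : Matrix m m ℂ) (B : ChainOp ι m) : Prop where
  state : EdgeState S r B
  value : EdgeValue r β B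

/-- Base case. [cite: BertiniKosProsen2019, eq. (8)] -/
theorem edgeData_onSite {y : ι} {b : Matrix m m ℂ} (hb : b.trace = 0) :
    EdgeData {y} y b (onSite y b) :=
  ⟨edgeState_onSite hb, edgeValue_onSite y b⟩

/-- Away step for the full data (a unitary gate not touching the edge). [cite: BertiniKosProsen2019,
eq. (13)] -/
theorem EdgeData.conj_away {S : Finset ι} {r : ι} {β : Matrix m m ℂ} {B : ChainOp ι m}
    (h : EdgeData S r β B) {p q : ι} (hpq : p ≠ q) (hrp : r ≠ p) (hrq : r ≠ q)
    {U : Matrix (m × m) (m × m) ℂ} (hU : U * Uᴴ = 1) :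
    EdgeData (S ∪ {p, q}) r β ((onPair p q U)ᴴ * B * onPair p q U) :=
  ⟨h.state.conj_away hrp hrq U, h.value.conj_away hpq hrp hrq hU⟩

/-- Edge step for the full data (a dual-unitary gate pairing the edge with a fresh site).
[cite: BertiniKosProsen2019, eqs. (14)–(18)] -/
theorem EdgeData.conj_edge [Nonempty m] {S : Finset ι} {r : ι} {β : Matrix m m ℂ}
    {B : ChainOp ι m} (h : EdgeData S r β B) (hr : r ∈ S) {q : ι} (hrq : r ≠ q) (hq : q ∉ S)
    {U : Matrix (m × m) (m × m) ℂ} (hU : reshuffle U * (reshuffle U)ᴴ = 1) :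
    EdgeData (insert q S) q (mPlus U β) ((onPair r q U)ᴴ * B * onPair r q U) :=
  ⟨h.state.conj_edge hr hrq hq hU, h.value.conj_edge h.state hrq hq U⟩

/-- **Properties 1 and 2 together (readout of the invariant).** With `dim = d^{|ι|}`:
`dim⁻¹ tr(a_z B) = [z = r] · d⁻¹ tr(a β)`. [cite: BertiniKosProsen2019, eqs. (12), (17)] -/
theorem EdgeData.correlation [Nonempty m] {S : Finset ι} {r : ι} {β : Matrix m m ℂ}
    {B : ChainOp ι m} (h : EdgeData S r β B) (z : ι) (a : Matrix m m ℂ) :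
    ((Fintype.card (ι → m) : ℂ))⁻¹ * (onSite z a * B).trace =
      if z = r then ((Fintype.card m : ℂ))⁻¹ * (a * β).trace else 0 := by
  by_cases hz : z = r
  · subst hz
    rw [if_pos rfl, h.value.trace_onSite_mul]
    have hK : (Fintype.card (ι → m) : ℂ) ≠ 0 := Nat.cast_ne_zero.mpr Fintype.card_ne_zero
    field_simp
  · rw [if_neg hz, h.state.trace_onSite_mul hz, mul_zero]

/-- The support bound may be enlarged. [folklore] -/
private theorem EdgeData.mono {S S' : Finset ι} (hSS' : S ⊆ S') {r : ι} {β : Matrix m m ℂ}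
    {B : ChainOp ι m} (h : EdgeData S r β B) : EdgeData S' r β B :=
  ⟨h.state.mono hSS', h.value⟩

/-! ### The brickwork circuit on an open chain of `N` sites -/

section Brickwork

variable {N : ℕ}

/-- The gate `U` on the bond `(p, p+1)` of the open chain `{0, …, N-1}` (the identity if the bond
does not exist, i.e. `p + 1 ≥ N`). [cite: FischerEtAl2026, Methods ‘Dual unitarity’ (the
dual-unitary gates `Û_{n,n+1}`, qubits `n = 0, 1, …, N-1`)] -/
def bondGate (U : Matrix (m × m) (m × m) ℂ) (p : ℕ) : ChainOp (Fin N) m :=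
  if h : p + 1 < N then onPair (⟨p, Nat.lt_of_succ_lt h⟩ : Fin N) ⟨p + 1, h⟩ U else 1

/-- Heisenberg conjugation `B ↦ G_{p_k}† ⋯ G_{p_1}† B G_{p_1} ⋯ G_{p_k}` by the bond gates at the
listed positions, in the listed order (the first listed gate acts first on `B`).
[cite: BertiniKosProsen2019, eq. (8) (`𝕌^{-t} a_y 𝕌^{t}`)] -/
def evolveBonds (U : Matrix (m × m) (m × m) ℂ) : List ℕ → ChainOp (Fin N) m → ChainOp (Fin N) m
  | [], B => B
  | p :: ps, B => evolveBonds U ps ((bondGate U p)ᴴ * B * bondGate U p)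

/-- `evolveBonds` is conjugation by the ordered product of the gates. [cite: BertiniKosProsen2019, eq. (8) (`𝕌^{-t} a_y 𝕌^t`)] -/
theorem evolveBonds_eq (U : Matrix (m × m) (m × m) ℂ) (ps : List ℕ) (B : ChainOp (Fin N) m) :
    evolveBonds U ps B = ((ps.map (bondGate U)).prod)ᴴ * B * (ps.map (bondGate U)).prod := by
  induction ps generalizing B with
  | nil => simp [evolveBonds]
  | cons p ps ih =>
      rw [evolveBonds, ih, List.map_cons, List.prod_cons, Matrix.conjTranspose_mul]
      simp only [Matrix.mul_assoc]

/-- The bonds of one brickwork layer of parity `π`: positions `p < N` with `p ≡ π (mod 2)`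
(even layer `Û_{2j,2j+1}`, odd layer `Û_{2j+1,2j+2}`). [cite: FischerEtAl2026, Methods ‘Dual
unitarity’ (`𝕌_e = Π_j Û_{2j,2j+1}`, `𝕌_o = Π_j Û_{2j-1,2j}`)] [cite: BertiniKosProsen2019,
eq. (2) (`𝕌^e = U^{⊗L}`, `𝕌^o = 𝕋 𝕌^e 𝕋†`)] -/
def layerBonds (N π : ℕ) : List ℕ := (List.range N).filter (fun p => p % 2 = π % 2)

/-- One brickwork layer of parity `π` as a unitary on the chain. [cite: FischerEtAl2026, Methods
‘Dual unitarity’] -/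
def layerOp (U : Matrix (m × m) (m × m) ℂ) (π : ℕ) : ChainOp (Fin N) m :=
  (((layerBonds N π).map (bondGate U))).prod

/-- **The brickwork evolution operator** for `t` layers of alternating parity, the layer of parity
`π` being the one adjacent to the Heisenberg operator (applied last in the Schrödinger picture):
`𝕍_π(t+1) = 𝕃_π 𝕍_{π+1}(t)`, so that `𝕍_π(t)† B 𝕍_π(t)` conjugates `B` first by the layer `π`, then
`π+1`, … ("We define our unit of time to be the evolution by single layer, odd or even").
[cite: FischerEtAl2026, Methods ‘Dual unitarity’ (`𝕌 = 𝕌_o 𝕌_e`, "repeated periodically")]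
[cite: BertiniKosProsen2019, eq. (2) (`𝕌 = 𝕌^o 𝕌^e`)] -/
def brick (U : Matrix (m × m) (m × m) ℂ) : ℕ → ℕ → ChainOp (Fin N) m
  | _, 0 => 1
  | π, t + 1 => layerOp U π * brick U (π + 1) t

omit [Fintype m] [DecidableEq m] in
/-- Membership in a layer's bond list. [folklore] -/
private theorem mem_layerBonds {N π p : ℕ} : p ∈ layerBonds N π ↔ p < N ∧ p % 2 = π % 2 := by
  simp [layerBonds, List.mem_filter, List.mem_range]

omit [Fintype m] [DecidableEq m] in
/-- A layer lists each bond once. [folklore] -/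
private theorem nodup_layerBonds (N π : ℕ) : (layerBonds N π).Nodup :=
  (List.nodup_range).filter _

/-- The support bound used along the open chain: all sites weakly left of the edge. [folklore] -/
private abbrev leftOf (r : Fin N) : Finset (Fin N) := Finset.univ.filter (fun z => z ≤ r)

omit [Fintype m] [DecidableEq m] in
/-- Membership in the support bound. [folklore] -/
private theorem mem_leftOf {r z : Fin N} : z ∈ leftOf r ↔ z.val ≤ r.val := by
  rw [Finset.mem_filter, Fin.le_def]
  simp only [Finset.mem_univ, true_and]

/-- A bond away from the edge (neither endpoint is the edge site) preserves the light-cone data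
with the same edge. [cite: BertiniKosProsen2019, eq. (13)] -/
theorem edgeData_bond_away [Nonempty m] {U : Matrix (m × m) (m × m) ℂ} (hU : IsDualUnitary U)
    {r : Fin N} {β : Matrix m m ℂ} {B : ChainOp (Fin N) m} (h : EdgeData (leftOf r) r β B)
    {p : ℕ} (hp : p ≠ r.val) (hp1 : p + 1 ≠ r.val) :
    EdgeData (leftOf r) r β ((bondGate U p)ᴴ * B * bondGate U p) := by
  unfold bondGate
  by_cases hN : p + 1 < N
  · rw [dif_pos hN]
    have hPQ : (⟨p, Nat.lt_of_succ_lt hN⟩ : Fin N) ≠ ⟨p + 1, hN⟩ := by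
      intro e
      rw [Fin.mk.injEq] at e
      omega
    by_cases hpr : r.val < p
    · -- both endpoints are right of the edge: outside the support, the gate cancels
      have hP : (⟨p, Nat.lt_of_succ_lt hN⟩ : Fin N) ∉ leftOf r := by rw [mem_leftOf]; simp; omega
      have hQ : (⟨p + 1, hN⟩ : Fin N) ∉ leftOf r := by rw [mem_leftOf]; simp; omega
      rw [h.state.conj_outside hPQ hP hQ hU.conjTranspose_mul]
      exact h
    · -- both endpoints are strictly left of the edge: inside the support
      have hrP : r ≠ ⟨p, Nat.lt_of_succ_lt hN⟩ := fun e => hp (by rw [e])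
      have hrQ : r ≠ ⟨p + 1, hN⟩ := fun e => hp1 (by rw [e])
      have h' := h.conj_away hPQ hrP hrQ hU.mul_conjTranspose
      have hsub : leftOf r ∪ {(⟨p, Nat.lt_of_succ_lt hN⟩ : Fin N), ⟨p + 1, hN⟩} = leftOf r := by
        rw [Finset.union_eq_left]
        intro z hz
        rw [Finset.mem_insert, Finset.mem_singleton] at hz
        rw [mem_leftOf]
        rcases hz with rfl | rfl <;> simp <;> omega
      rw [hsub] at h'
      exact h'
  · rw [dif_neg hN, Matrix.conjTranspose_one, Matrix.one_mul, Matrix.mul_one]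
    exact h

/-- The bond at the edge moves the edge one site to the right and applies `M₊` to the edge
marginal. [cite: BertiniKosProsen2019, eqs. (14)–(18)] -/
theorem edgeData_bond_edge [Nonempty m] {U : Matrix (m × m) (m × m) ℂ} (hU : IsDualUnitary U)
    {r : Fin N} {β : Matrix m m ℂ} {B : ChainOp (Fin N) m} (h : EdgeData (leftOf r) r β B)
    (hr1 : r.val + 1 < N) :
    EdgeData (leftOf ⟨r.val + 1, hr1⟩) ⟨r.val + 1, hr1⟩ (mPlus U β)
      ((bondGate U r.val)ᴴ * B * bondGate U r.val) := by
  unfold bondGate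
  rw [dif_pos hr1]
  have hrQ : r ≠ ⟨r.val + 1, hr1⟩ := by
    intro e
    have := congrArg Fin.val e
    simp at this
  have hQ : (⟨r.val + 1, hr1⟩ : Fin N) ∉ leftOf r := by rw [mem_leftOf]; simp
  have hr : r ∈ leftOf r := by rw [mem_leftOf]
  have h' := h.conj_edge hr hrQ hQ hU.reshuffle_mul_conjTranspose
  refine h'.mono ?_
  intro z hz
  rw [Finset.mem_insert] at hz
  rw [mem_leftOf]
  rcases hz with rfl | hz
  · simp
  · rw [mem_leftOf] at hz
    simp
    omega

/-- A list of bonds none of which touches the edge preserves the light-cone data.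
[cite: BertiniKosProsen2019, eq. (13)] -/
theorem edgeData_evolveBonds_away [Nonempty m] {U : Matrix (m × m) (m × m) ℂ}
    (hU : IsDualUnitary U) {r : Fin N} {β : Matrix m m ℂ} (ps : List ℕ)
    (hps : ∀ p ∈ ps, p ≠ r.val ∧ p + 1 ≠ r.val) {B : ChainOp (Fin N) m}
    (h : EdgeData (leftOf r) r β B) : EdgeData (leftOf r) r β (evolveBonds U ps B) := by
  induction ps generalizing B with
  | nil => exact h
  | cons p ps ih =>
      rw [evolveBonds]
      have hp := hps p (by simp)
      exact ih (fun p' hp' => hps p' (List.mem_cons_of_mem _ hp')) (edgeData_bond_away hU h hp.1 hp.2)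

/-- **One brickwork layer** whose parity matches the edge site moves the edge by one site and
applies `M₊` once. [cite: BertiniKosProsen2019, Property 1 ("a lightcone spreading at speed 1")
and Property 2 (one factor `M₊` per layer)] -/
theorem edgeData_evolveBonds_layer [Nonempty m] {U : Matrix (m × m) (m × m) ℂ}
    (hU : IsDualUnitary U) {r : Fin N} {β : Matrix m m ℂ} (ps : List ℕ)
    (hpar : ∀ p ∈ ps, p % 2 = r.val % 2) (hnd : ps.Nodup) (hmem : r.val ∈ ps)
    (hr1 : r.val + 1 < N) {B : ChainOp (Fin N) m} (h : EdgeData (leftOf r) r β B) :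
    EdgeData (leftOf ⟨r.val + 1, hr1⟩) ⟨r.val + 1, hr1⟩ (mPlus U β) (evolveBonds U ps B) := by
  induction ps generalizing B with
  | nil => simp at hmem
  | cons p ps ih =>
      rw [evolveBonds]
      rw [List.nodup_cons] at hnd
      by_cases hp : p = r.val
      · subst hp
        have h1 := edgeData_bond_edge hU h hr1
        refine edgeData_evolveBonds_away hU ps (fun p' hp' => ⟨?_, ?_⟩) h1
        · -- parity: p' ≡ r, the new edge r+1 has the other parity
          have := hpar p' (List.mem_cons_of_mem _ hp')
          simp only
          omega
        · simp only
          intro e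
          exact hnd.1 (by have : p' = r.val := by omega
                          rw [← this]; exact hp')
      · have hp1 : p + 1 ≠ r.val := by
          have := hpar p (by simp)
          omega
        have hmem' : r.val ∈ ps := by
          rcases List.mem_cons.mp hmem with e | e
          · exact absurd e.symm hp
          · exact e
        exact ih (fun p' hp' => hpar p' (List.mem_cons_of_mem _ hp')) hnd.2 hmem'
          (edgeData_bond_away hU h hp hp1)

/-- **The light-cone data after `t` brickwork layers**: edge at `y + t`, edge marginal `M₊^t(b)`.
[cite: BertiniKosProsen2019, Properties 1–2] [cite: FischerEtAl2026, eq. (2)] -/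
theorem edgeData_brick [Nonempty m] {U : Matrix (m × m) (m × m) ℂ} (hU : IsDualUnitary U)
    (t : ℕ) : ∀ (π : ℕ) (y r : Fin N) (β : Matrix m m ℂ) (B : ChainOp (Fin N) m),
      π % 2 = y.val % 2 → r.val = y.val + t → EdgeData (leftOf y) y β B →
      EdgeData (leftOf r) r ((mPlus U)^[t] β) ((brick U π t)ᴴ * B * brick U π t) := by
  induction t with
  | zero =>
      intro π y r β B _ hr h
      have : r = y := Fin.ext (by omega)
      subst this
      simpa [brick] using h
  | succ t ih =>
      intro π y r β B hπ hr h
      have hy1 : y.val + 1 < N := by have := r.isLt; omega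
      rw [brick, Matrix.conjTranspose_mul]
      have hassoc : (brick U (π + 1) t)ᴴ * (layerOp U π)ᴴ * B * (layerOp U π * brick U (π + 1) t) =
          (brick U (π + 1) t)ᴴ * ((layerOp U π)ᴴ * B * layerOp U π) * brick U (π + 1) t := by
        simp only [Matrix.mul_assoc]
      rw [hassoc]
      have hlayer : (layerOp U π)ᴴ * B * layerOp U π = evolveBonds U (layerBonds N π) B := by
        rw [evolveBonds_eq]
        rfl
      rw [hlayer]
      have h1 : EdgeData (leftOf ⟨y.val + 1, hy1⟩) ⟨y.val + 1, hy1⟩ (mPlus U β)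
          (evolveBonds U (layerBonds N π) B) :=
        edgeData_evolveBonds_layer hU (layerBonds N π)
          (fun p hp => by rw [(mem_layerBonds.mp hp).2, hπ]) (nodup_layerBonds N π)
          (mem_layerBonds.mpr ⟨y.isLt, hπ.symm⟩) hy1 h
      have h2 := ih (π + 1) ⟨y.val + 1, hy1⟩ r (mPlus U β) _ (by simp only; omega)
        (by simp only; omega) h1
      rwa [← Function.iterate_succ_apply] at h2

/-- **Bertini–Kos–Prosen Properties 1 and 2 / Fischer et al. eq. (2), for the brickwork of a
dual-unitary gate `U` on an open chain of `N` qudits.** For a traceless single-site `b` at site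
`y`, evolved in the Heisenberg picture through `t` brickwork layers the first of which pairs
`(y, y+1)` (parity `π ≡ y`), and any single-site probe `a` at site `z`, as long as the light-cone
edge stays on the chain (`y + t < N`):
`d^{-N} tr[a_z · 𝕍† b_y 𝕍] = δ_{z, y+t} · d⁻¹ tr[a M₊^t(b)]`
— zero everywhere except on the light-cone edge travelling at speed one ("non-zero only on the
edges of a lightcone spreading at speed 1"), where it is given by `t` powers of the single-gate
channel `M₊` (`DualUnitary.mPlus`, eq. (18)). [cite: BertiniKosProsen2019, Property 1 eq. (12)
and Property 2 eq. (17)] [cite: FischerEtAl2026, eq. (2) (`C_n(t) = 0` unless `n = t`) and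
text ("the autocorrelation function vanishes outside of the light cone boundary of n = t")] -/
theorem brickwork_correlation [Nonempty m] {U : Matrix (m × m) (m × m) ℂ} (hU : IsDualUnitary U)
    {b : Matrix m m ℂ} (hb : b.trace = 0) (π t : ℕ) (y z : Fin N) (hπ : π % 2 = y.val % 2)
    (hyt : y.val + t < N) (a : Matrix m m ℂ) :
    ((Fintype.card (Fin N → m) : ℂ))⁻¹ *
        (onSite z a * ((brick U π t)ᴴ * onSite y b * brick U π t)).trace =
      if z.val = y.val + t then ((Fintype.card m : ℂ))⁻¹ * (a * (mPlus U)^[t] b).trace else 0 := by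
  have hdata := edgeData_brick hU t π y ⟨y.val + t, hyt⟩ b (onSite y b) hπ rfl
    ((edgeData_onSite hb).mono (by intro z hz; rw [Finset.mem_singleton] at hz; rw [mem_leftOf, hz]))
  rw [hdata.correlation z a]
  have hiff : (z = ⟨y.val + t, hyt⟩) ↔ z.val = y.val + t := by
    constructor
    · intro e; rw [e]
    · intro e; exact Fin.ext e
  by_cases hz : z.val = y.val + t
  · rw [if_pos (hiff.mpr hz), if_pos hz]
  · rw [if_neg (fun e => hz (hiff.mp e)), if_neg hz]

end Brickwork

/-! ### Fischer et al.'s exactly-verifiable signal: the self-dual kicked Ising brickwork -/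

section KickedIsingChain

/-- **Fischer et al. eq. (2), many-body statement.** For the brickwork of the self-dual kicked-Ising
gate `U_KI(π/4, π/4, h)` (`KickedIsing.gate`, dual-unitary for every `h`) on an open chain of `N`
qubits, the infinite-temperature correlation of `σˣ` at site `y` — Heisenberg-evolved through `t`
layers, the first pairing `(y, y+1)` — with `σˣ` at site `z` is
`2^{-N} tr[σˣ_z 𝕍† σˣ_y 𝕍] = δ_{z, y+t} [cos(2h)]^t` (`y + t < N`): zero off the light-cone edge,
`[cos 2h]^t` on it — constant at the Clifford point `h = 0`, exponentially decaying otherwise.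
[cite: FischerEtAl2026, eq. (2) (`C_n(t) = [cos(2h)]^t` if `n = t`, `0` otherwise, "for
t ≤ (N−1)/2") and text ("As predicted analytically, we observe a negligible signal for t ≠ n and
finite signal is only measured along the light-cone boundary for t = n")]
[cite: BertiniKosProsen2019, Properties 1–2, eqs. (12), (17)] -/
theorem kickedIsing_selfDual_correlation (h : ℝ) {N : ℕ} (π t : ℕ) (y z : Fin N)
    (hπ : π % 2 = y.val % 2) (hyt : y.val + t < N) :
    ((Fintype.card (Fin N → Bool) : ℂ))⁻¹ *
        (onSite z (Pauli.mat Pauli.X) *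
          ((brick (KickedIsing.gate (Real.pi / 4) (Real.pi / 4) h) π t)ᴴ *
            onSite y (Pauli.mat Pauli.X) *
              brick (KickedIsing.gate (Real.pi / 4) (Real.pi / 4) h) π t)).trace =
      if z.val = y.val + t then (Real.cos (2 * h) : ℂ) ^ t else 0 := by
  have hX : (Pauli.mat Pauli.X).trace = 0 := by
    rw [Matrix.trace, Fintype.sum_bool, Matrix.diag_apply, Matrix.diag_apply, Pauli.mat_X_apply,
      Pauli.mat_X_apply]
    simp
  rw [brickwork_correlation (KickedIsing.isDualUnitary_gate_selfDual h) hX π t y z hπ hyt,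
    Fintype.card_bool]
  by_cases hz : z.val = y.val + t
  · rw [if_pos hz, if_pos hz, ← KickedIsing.half_trace_X_mul_iterate_mPlus_gate_selfDual h t]
    norm_num
  · rw [if_neg hz, if_neg hz]

end KickedIsingChain

/-! ## (v2) The mirror family `ν = −`: left-moving edge, channel `M₋`

The same argument read right-to-left: an operator sitting on the SECOND site of its first gate moves
left one site per layer and its edge marginal is updated by `M₋(a) = d⁻¹ tr₂[U† (𝟙 ⊗ a) U]`
(`DualUnitary.mMinus`). [cite: BertiniKosProsen2019, Property 1 eq. (12) with ν = −, Property 2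
eq. (17) (`C_−(−t,t) = (1/d) tr[M_−^{2t}(a^β) a^α]`) and eq. (19)] -/

section LeftMovers

/-- Freeness at `x` on configurations updated at `x` then `y` (mirror of `Free.apply_update₂`).
[folklore] -/
private theorem Free.apply_update₂' {x y : ι} (hxy : x ≠ y) {M : ChainOp ι m} (hM : Free x M)
    (s t : ι → m) (hst : s x = t x) (a a' b b' : m) :
    M (Function.update (Function.update s x a) y b)
        (Function.update (Function.update t x a') y b') =
      if a = a' then M (Function.update s y b) (Function.update t y b') else 0 := by
  by_cases ha : a = a'
  · rw [if_pos ha, ha, Function.update_comm hxy a' b s, Function.update_comm hxy a' b' t]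
    exact hM.apply_update _ _ (by rw [Function.update_of_ne hxy, Function.update_of_ne hxy, hst]) a'
  · rw [if_neg ha]
    refine hM.apply_eq_zero ?_
    rw [Function.update_of_ne hxy, Function.update_of_ne hxy, Function.update_self,
      Function.update_self]
    exact ha

/-- The finite sum behind the mirror sideways rule: `Σ_{a,c} U_{(a,b'),(c,p')} conj U_{(a,b),(c,p)}
= (U^R† U^R)_{(b,p),(b',p')}`. [cite: BertiniKosProsen2019, SM §1 (dual fusion rules)] -/
private theorem sideways_sum' {U : Matrix (m × m) (m × m) ℂ} (hU : (reshuffle U)ᴴ * reshuffle U = 1)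
    (F : m → m → ℂ) (p p' : m) :
    (∑ c, ∑ a, ∑ b, ∑ b', star (U (a, b) (c, p)) * (F b b' * U (a, b') (c, p'))) =
      if p' = p then ∑ b, F b b else 0 := by
  have inner : ∀ b b' : m, (∑ a, ∑ c, star (U (a, b) (c, p)) * U (a, b') (c, p')) =
      ((reshuffle U)ᴴ * reshuffle U) (b, p) (b', p') := by
    intro b b'
    rw [Matrix.mul_apply, Fintype.sum_prod_type]
    refine Finset.sum_congr rfl fun a _ => Finset.sum_congr rfl fun c _ => ?_
    rw [Matrix.conjTranspose_apply, reshuffle_apply, reshuffle_apply]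
  calc (∑ c, ∑ a, ∑ b, ∑ b', star (U (a, b) (c, p)) * (F b b' * U (a, b') (c, p')))
      = ∑ c, ∑ a, ∑ b, ∑ b', F b b' * (star (U (a, b) (c, p)) * U (a, b') (c, p')) :=
        Finset.sum_congr rfl fun c _ => Finset.sum_congr rfl fun a _ =>
          Finset.sum_congr rfl fun b _ => Finset.sum_congr rfl fun b' _ => by ring
    _ = ∑ c, ∑ b, ∑ b', ∑ a, F b b' * (star (U (a, b) (c, p)) * U (a, b') (c, p')) :=
        Finset.sum_congr rfl fun c _ => by
          rw [Finset.sum_comm]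
          refine Finset.sum_congr rfl fun b _ => ?_
          rw [Finset.sum_comm]
    _ = ∑ b, ∑ b', ∑ c, ∑ a, F b b' * (star (U (a, b) (c, p)) * U (a, b') (c, p')) := by
        rw [Finset.sum_comm]
        refine Finset.sum_congr rfl fun b _ => ?_
        rw [Finset.sum_comm]
    _ = ∑ b, ∑ b', F b b' * ∑ a, ∑ c, star (U (a, b) (c, p)) * U (a, b') (c, p') :=
        Finset.sum_congr rfl fun b _ => Finset.sum_congr rfl fun b' _ => by
          rw [Finset.mul_sum, Finset.sum_comm]
          refine Finset.sum_congr rfl fun a _ => ?_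
          rw [Finset.mul_sum]
    _ = ∑ b, ∑ b', F b b' * ((reshuffle U)ᴴ * reshuffle U) (b, p) (b', p') :=
        Finset.sum_congr rfl fun b _ => Finset.sum_congr rfl fun b' _ => by rw [inner]
    _ = if p' = p then ∑ b, F b b else 0 := by
        rw [hU]
        simp only [Matrix.one_apply, Prod.mk.injEq, mul_ite, mul_one, mul_zero]
        by_cases hp : p' = p
        · rw [if_pos hp]
          refine Finset.sum_congr rfl fun b _ => ?_
          rw [Finset.sum_eq_single_of_mem b (Finset.mem_univ _)]
          · rw [if_pos ⟨rfl, hp.symm⟩]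
          · intro b' _ hb'
            exact if_neg fun h => hb' h.1.symm
        · rw [if_neg hp]
          apply Finset.sum_eq_zero
          intro b _
          apply Finset.sum_eq_zero
          intro b' _
          exact if_neg fun h => hp h.2.symm

/-- **The mirror sideways rule.** If `(U^R)† U^R = 𝟙` and `M` is free of the FIRST site `x` of the
gate, then `E_x(U_{xy}† M U_{xy}) = E_y(M)`: the operator sitting on the second input leaves no trace
on the second output. [cite: BertiniKosProsen2019, eq. (7) (`Ũ†Ũ = 𝟙`) and the proof of Property 1
("the procedure for ν = − is analogous")] -/
theorem erase_conj_onPair_of_free_fst {x y : ι} (hxy : x ≠ y) {U : Matrix (m × m) (m × m) ℂ}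
    (hU : (reshuffle U)ᴴ * reshuffle U = 1) {M : ChainOp ι m} (hM : Free x M) :
    erase x ((onPair x y U)ᴴ * M * onPair x y U) = erase y M := by
  ext s t
  rw [erase_apply, erase_apply]
  by_cases hst : s x = t x
  · rw [if_pos hst]
    have hc : ∀ c : m, ((onPair x y U)ᴴ * M * onPair x y U) (Function.update s x c)
        (Function.update t x c) = ∑ a, ∑ b, ∑ b', star (U (a, b) (c, s y)) *
          (M (Function.update s y b) (Function.update t y b') * U (a, b') (c, t y)) := by
      intro c
      rw [conj_onPair_apply hxy]
      simp only [Function.update_self, Function.update_of_ne (Ne.symm hxy), Function.update_idem,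
        hM.apply_update₂' hxy s t hst]
      refine Finset.sum_congr rfl fun a _ => Finset.sum_congr rfl fun b _ => ?_
      rw [Finset.sum_eq_single_of_mem a (Finset.mem_univ _)]
      · simp only [if_true]
      · intro a' _ ha'
        apply Finset.sum_eq_zero
        intro b' _
        rw [if_neg (Ne.symm ha'), zero_mul, mul_zero]
    simp only [hc]
    rw [sideways_sum' hU (fun b b' => M (Function.update s y b) (Function.update t y b')) (s y) (t y)]
    by_cases hy : s y = t y
    · rw [if_pos hy, if_pos hy.symm]
    · rw [if_neg hy, if_neg (fun h => hy h.symm), mul_zero]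
  · rw [if_neg hst]
    by_cases hy : s y = t y
    · rw [if_pos hy]
      symm
      rw [mul_eq_zero]
      right
      exact Finset.sum_eq_zero fun b _ => hM.apply_eq_zero (by
        rw [Function.update_of_ne hxy, Function.update_of_ne hxy]; exact hst)
    · rw [if_neg hy]

/-- For a dual-unitary gate: `(U^R)† U^R = 𝟙`. [cite: BertiniKosProsen2019, eq. (7)] -/
theorem _root_.Literature.MathematicalPhysics.QuantumLattice.DualUnitary.IsDualUnitary.conjTranspose_mul_reshuffle
    {U : Matrix (m × m) (m × m) ℂ} (hU : IsDualUnitary U) :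
    (reshuffle U)ᴴ * reshuffle U = 1 := by
  have h := ((isDualUnitary_iff_reshuffle U).mp hU).2
  have := Matrix.mem_unitaryGroup_iff'.mp h
  rwa [Matrix.star_eq_conjTranspose] at this

/-- Erasing the first site of a two-site operator: `E_x(X_{xy}) = d⁻¹ (tr₁ X)_y`.
[cite: ManentiMotta2023, §6.6.1 eqs. (6.49)–(6.51)] -/
theorem erase_onPair_fst {x y : ι} (hxy : x ≠ y) (X : Matrix (m × m) (m × m) ℂ) :
    erase x (onPair x y X) = ((Fintype.card m : ℂ))⁻¹ • onSite y (traceLeft X) := by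
  ext s t
  rw [erase_apply, Matrix.smul_apply, smul_eq_mul, onSite_apply, traceLeft_apply]
  simp only [onPair_apply, Function.update_self, Function.update_of_ne (Ne.symm hxy)]
  have hc : ∀ c : m, (∀ k, k ≠ x → k ≠ y → Function.update s x c k = Function.update t x c k) ↔
      (∀ k, k ≠ x → k ≠ y → s k = t k) := by
    intro c
    refine forall_congr' fun k => imp_congr_right fun hkx => imp_congr_right fun _ => ?_
    rw [Function.update_of_ne hkx, Function.update_of_ne hkx]
  by_cases hst : s x = t x
  · rw [if_pos hst]
    by_cases hA : ∀ k, k ≠ x → k ≠ y → s k = t k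
    · have hA' : ∀ k, k ≠ y → s k = t k :=
        fun k hk => if hkx : k = x then hkx ▸ hst else hA k hkx hk
      rw [if_pos hA']
      congr 1
      refine Finset.sum_congr rfl fun c _ => ?_
      rw [if_pos ((hc c).mpr hA)]
    · have hA' : ¬ ∀ k, k ≠ y → s k = t k := fun h => hA fun k hk _ => h k ?_
      · rw [if_neg hA', mul_zero]
        rw [mul_eq_zero]
        right
        exact Finset.sum_eq_zero fun c _ => if_neg fun h => hA ((hc c).mp h)
      · intro hky
        exact absurd hky ‹k ≠ y›
  · rw [if_neg hst, if_neg (fun h => hst (h x hxy)), mul_zero]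

/-- Conjugating a single-site operator on the FIRST site by the gate:
`U_{xy} a_x U_{xy}† = (U (a ⊗ 𝟙) U†)_{xy}`. [cite: ManentiMotta2023, §3.2.15 eqs. (3.91)–(3.92)] -/
theorem onPair_mul_onSite_fst_mul_conjTranspose {x y : ι} (hxy : x ≠ y)
    (U : Matrix (m × m) (m × m) ℂ) (a : Matrix m m ℂ) :
    onPair x y U * onSite x a * (onPair x y U)ᴴ =
      onPair x y (U * (a ⊗ₖ (1 : Matrix m m ℂ)) * Uᴴ) := by
  rw [← onPair_kronecker_one hxy, onPair_mul hxy, onPair_conjTranspose, onPair_mul hxy]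

/-- **The one-gate input of Property 2 for left movers**:
`tr(a · M₋(β)) = d⁻¹ tr(tr₁[U (a ⊗ 𝟙) U†] · β)`. [cite: BertiniKosProsen2019, eq. (19)] -/
theorem trace_mul_mMinus (U : Matrix (m × m) (m × m) ℂ) (a β : Matrix m m ℂ) :
    (a * mMinus U β).trace =
      ((Fintype.card m : ℂ))⁻¹ * (traceLeft (U * (a ⊗ₖ (1 : Matrix m m ℂ)) * Uᴴ) * β).trace := by
  unfold mMinus
  rw [Matrix.mul_smul, Matrix.trace_smul, smul_eq_mul]
  congr 1
  rw [← trace_kronecker_one_mul, Matrix.trace_mul_comm (traceLeft _) β, ← trace_one_kronecker_mul]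
  calc ((a ⊗ₖ (1 : Matrix m m ℂ)) * (Uᴴ * ((1 : Matrix m m ℂ) ⊗ₖ β) * U)).trace
      = ((a ⊗ₖ (1 : Matrix m m ℂ)) * Uᴴ * ((1 : Matrix m m ℂ) ⊗ₖ β) * U).trace := by
        simp only [Matrix.mul_assoc]
    _ = (U * ((a ⊗ₖ (1 : Matrix m m ℂ)) * Uᴴ * ((1 : Matrix m m ℂ) ⊗ₖ β))).trace :=
        Matrix.trace_mul_comm _ _
    _ = ((U * (a ⊗ₖ (1 : Matrix m m ℂ)) * Uᴴ) * ((1 : Matrix m m ℂ) ⊗ₖ β)).trace := by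
        simp only [Matrix.mul_assoc]
    _ = (((1 : Matrix m m ℂ) ⊗ₖ β) * (U * (a ⊗ₖ (1 : Matrix m m ℂ)) * Uᴴ)).trace :=
        Matrix.trace_mul_comm _ _

/-- **Edge step, left movers.** A gate pairing a fresh site `q ∉ S` (first) with the edge `r ∈ S`
(second) moves the edge to `q`. [cite: BertiniKosProsen2019, proof of Property 1 ("the procedure
for ν = − is analogous")] -/
theorem EdgeState.conj_edge_left {S : Finset ι} {r : ι} {B : ChainOp ι m} (h : EdgeState S r B)
    (hr : r ∈ S) {q : ι} (hqr : q ≠ r) (hq : q ∉ S) {U : Matrix (m × m) (m × m) ℂ}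
    (hU : (reshuffle U)ᴴ * reshuffle U = 1) :
    EdgeState (insert q S) q ((onPair q r U)ᴴ * B * onPair q r U) := by
  refine ⟨fun z hz => ?_, ?_⟩
  · rw [Finset.mem_insert, not_or] at hz
    have hzr : z ≠ r := fun h' => hz.2 (h' ▸ hr)
    have hG : Free z (onPair q r U) := free_onPair hz.1 hzr U
    exact (hG.conjTranspose.mul (h.free z hz.2)).mul hG
  · rw [erase_conj_onPair_of_free_fst hqr hU (h.free q hq), h.erased]

/-- **Edge step for the value, left movers**: `β ↦ M₋(β)`. [cite: BertiniKosProsen2019,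
Property 2 / eq. (17) with ν = − and eq. (19)] -/
theorem EdgeValue.conj_edge_left [Nonempty m] {S : Finset ι} {r : ι} {β : Matrix m m ℂ}
    {B : ChainOp ι m} (hv : EdgeValue r β B) (hs : EdgeState S r B) {q : ι} (hqr : q ≠ r)
    (hq : q ∉ S) (U : Matrix (m × m) (m × m) ℂ) :
    EdgeValue q (mMinus U β) ((onPair q r U)ᴴ * B * onPair q r U) := by
  intro a
  have hBq : Free q B := hs.free q hq
  rw [trace_probe_conj, onPair_mul_onSite_fst_mul_conjTranspose hqr,
    trace_mul_eq_trace_erase_mul q _ hBq, erase_onPair_fst hqr, Matrix.smul_mul, Matrix.trace_smul,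
    smul_eq_mul, hv, trace_onSite, trace_onSite, trace_mul_mMinus]
  ring

/-- Edge step for the full data, left movers. [cite: BertiniKosProsen2019, eqs. (14)–(19)] -/
theorem EdgeData.conj_edge_left [Nonempty m] {S : Finset ι} {r : ι} {β : Matrix m m ℂ}
    {B : ChainOp ι m} (h : EdgeData S r β B) (hr : r ∈ S) {q : ι} (hqr : q ≠ r) (hq : q ∉ S)
    {U : Matrix (m × m) (m × m) ℂ} (hU : (reshuffle U)ᴴ * reshuffle U = 1) :
    EdgeData (insert q S) q (mMinus U β) ((onPair q r U)ᴴ * B * onPair q r U) :=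
  ⟨h.state.conj_edge_left hr hqr hq hU, h.value.conj_edge_left h.state hqr hq U⟩

end LeftMovers

/-! ### Left movers on the open chain -/

section BrickworkLeft

variable {N : ℕ}

/-- The support bound for left movers: all sites weakly right of the edge. [folklore] -/
private abbrev rightOf (r : Fin N) : Finset (Fin N) := Finset.univ.filter (fun z => r ≤ z)

/-- Membership in the support bound. [folklore] -/
private theorem mem_rightOf {r z : Fin N} : z ∈ rightOf r ↔ r.val ≤ z.val := by
  rw [Finset.mem_filter, Fin.le_def]
  simp only [Finset.mem_univ, true_and]

/-- A bond away from the (left-moving) edge preserves the light-cone data.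
[cite: BertiniKosProsen2019, eq. (13)] -/
theorem edgeData_bond_away_left [Nonempty m] {U : Matrix (m × m) (m × m) ℂ} (hU : IsDualUnitary U)
    {r : Fin N} {β : Matrix m m ℂ} {B : ChainOp (Fin N) m} (h : EdgeData (rightOf r) r β B)
    {p : ℕ} (hp : p ≠ r.val) (hp1 : p + 1 ≠ r.val) :
    EdgeData (rightOf r) r β ((bondGate U p)ᴴ * B * bondGate U p) := by
  unfold bondGate
  by_cases hN : p + 1 < N
  · rw [dif_pos hN]
    have hPQ : (⟨p, Nat.lt_of_succ_lt hN⟩ : Fin N) ≠ ⟨p + 1, hN⟩ := by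
      intro e
      rw [Fin.mk.injEq] at e
      omega
    by_cases hpr : p + 1 < r.val
    · -- both endpoints strictly left of the edge: outside the support, the gate cancels
      have hP : (⟨p, Nat.lt_of_succ_lt hN⟩ : Fin N) ∉ rightOf r := by rw [mem_rightOf]; simp; omega
      have hQ : (⟨p + 1, hN⟩ : Fin N) ∉ rightOf r := by rw [mem_rightOf]; simp; omega
      rw [h.state.conj_outside hPQ hP hQ hU.conjTranspose_mul]
      exact h
    · -- both endpoints strictly right of the edge: inside the support
      have hrP : r ≠ ⟨p, Nat.lt_of_succ_lt hN⟩ := fun e => hp (by rw [e])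
      have hrQ : r ≠ ⟨p + 1, hN⟩ := fun e => hp1 (by rw [e])
      have h' := h.conj_away hPQ hrP hrQ hU.mul_conjTranspose
      have hsub : rightOf r ∪ {(⟨p, Nat.lt_of_succ_lt hN⟩ : Fin N), ⟨p + 1, hN⟩} = rightOf r := by
        rw [Finset.union_eq_left]
        intro z hz
        rw [Finset.mem_insert, Finset.mem_singleton] at hz
        rw [mem_rightOf]
        rcases hz with rfl | rfl <;> simp <;> omega
      rw [hsub] at h'
      exact h'
  · rw [dif_neg hN, Matrix.conjTranspose_one, Matrix.one_mul, Matrix.mul_one]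
    exact h

/-- The bond ending at the edge moves the (left-moving) edge one site to the left and applies `M₋`.
[cite: BertiniKosProsen2019, eqs. (14)–(19)] -/
theorem edgeData_bond_edge_left [Nonempty m] {U : Matrix (m × m) (m × m) ℂ}
    (hU : IsDualUnitary U) {r : Fin N} {β : Matrix m m ℂ} {B : ChainOp (Fin N) m}
    (h : EdgeData (rightOf r) r β B) {p : ℕ} (hp1 : p + 1 = r.val) :
    EdgeData (rightOf ⟨p, by omega⟩) ⟨p, by omega⟩ (mMinus U β)
      ((bondGate U p)ᴴ * B * bondGate U p) := by
  have hN : p + 1 < N := by have := r.isLt; omega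
  have hQr : (⟨p + 1, hN⟩ : Fin N) = r := Fin.ext (by simp [hp1])
  unfold bondGate
  rw [dif_pos hN, hQr]
  have hPr : (⟨p, Nat.lt_of_succ_lt hN⟩ : Fin N) ≠ r := by
    intro e
    have := congrArg Fin.val e
    simp at this
    omega
  have hP : (⟨p, Nat.lt_of_succ_lt hN⟩ : Fin N) ∉ rightOf r := by rw [mem_rightOf]; simp; omega
  have hr : r ∈ rightOf r := by rw [mem_rightOf]
  have h' := h.conj_edge_left hr hPr hP hU.conjTranspose_mul_reshuffle
  refine h'.mono ?_
  intro z hz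
  rw [Finset.mem_insert] at hz
  rw [mem_rightOf]
  rcases hz with rfl | hz
  · simp
  · rw [mem_rightOf] at hz
    simp
    omega

/-- A list of bonds none of which touches the edge preserves the data (left movers).
[cite: BertiniKosProsen2019, eq. (13)] -/
theorem edgeData_evolveBonds_away_left [Nonempty m] {U : Matrix (m × m) (m × m) ℂ}
    (hU : IsDualUnitary U) {r : Fin N} {β : Matrix m m ℂ} (ps : List ℕ)
    (hps : ∀ p ∈ ps, p ≠ r.val ∧ p + 1 ≠ r.val) {B : ChainOp (Fin N) m}
    (h : EdgeData (rightOf r) r β B) : EdgeData (rightOf r) r β (evolveBonds U ps B) := by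
  induction ps generalizing B with
  | nil => exact h
  | cons p ps ih =>
      rw [evolveBonds]
      have hp := hps p (by simp)
      exact ih (fun p' hp' => hps p' (List.mem_cons_of_mem _ hp'))
        (edgeData_bond_away_left hU h hp.1 hp.2)

/-- One brickwork layer whose parity is opposite to the edge site moves the left-moving edge by one
site and applies `M₋` once. [cite: BertiniKosProsen2019, Properties 1–2 with ν = −] -/
theorem edgeData_evolveBonds_layer_left [Nonempty m] {U : Matrix (m × m) (m × m) ℂ}
    (hU : IsDualUnitary U) {r : Fin N} {β : Matrix m m ℂ} (ps : List ℕ)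
    (hpar : ∀ p ∈ ps, p % 2 = (r.val + 1) % 2) (hnd : ps.Nodup) {p₀ : ℕ} (hp₀ : p₀ + 1 = r.val)
    (hmem : p₀ ∈ ps) {B : ChainOp (Fin N) m} (h : EdgeData (rightOf r) r β B) :
    EdgeData (rightOf ⟨p₀, by omega⟩) ⟨p₀, by omega⟩ (mMinus U β) (evolveBonds U ps B) := by
  induction ps generalizing B with
  | nil => simp at hmem
  | cons p ps ih =>
      rw [evolveBonds]
      rw [List.nodup_cons] at hnd
      by_cases hp : p = p₀
      · subst hp
        have h1 := edgeData_bond_edge_left hU h hp₀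
        refine edgeData_evolveBonds_away_left hU ps (fun p' hp' => ⟨?_, ?_⟩) h1
        · simp only
          intro e
          exact hnd.1 (e ▸ hp')
        · have := hpar p' (List.mem_cons_of_mem _ hp')
          simp only
          omega
      · have hp1 : p + 1 ≠ r.val := by omega
        have hp' : p ≠ r.val := by
          have := hpar p (by simp)
          omega
        have hmem' : p₀ ∈ ps := by
          rcases List.mem_cons.mp hmem with e | e
          · exact absurd e.symm hp
          · exact e
        exact ih (fun p' hp' => hpar p' (List.mem_cons_of_mem _ hp')) hnd.2 hmem'
          (edgeData_bond_away_left hU h hp' hp1)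

/-- The light-cone data after `t` layers, left movers: edge at `y − t`, marginal `M₋^t(b)`.
[cite: BertiniKosProsen2019, Properties 1–2 with ν = −] -/
theorem edgeData_brick_left [Nonempty m] {U : Matrix (m × m) (m × m) ℂ} (hU : IsDualUnitary U)
    (t : ℕ) : ∀ (π : ℕ) (y r : Fin N) (β : Matrix m m ℂ) (B : ChainOp (Fin N) m),
      π % 2 = (y.val + 1) % 2 → r.val + t = y.val → EdgeData (rightOf y) y β B →
      EdgeData (rightOf r) r ((mMinus U)^[t] β) ((brick U π t)ᴴ * B * brick U π t) := by
  induction t with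
  | zero =>
      intro π y r β B _ hr h
      have : r = y := Fin.ext (by omega)
      subst this
      simpa [brick] using h
  | succ t ih =>
      intro π y r β B hπ hr h
      have hy1 : 1 ≤ y.val := by omega
      rw [brick, Matrix.conjTranspose_mul]
      have hassoc : (brick U (π + 1) t)ᴴ * (layerOp U π)ᴴ * B * (layerOp U π * brick U (π + 1) t) =
          (brick U (π + 1) t)ᴴ * ((layerOp U π)ᴴ * B * layerOp U π) * brick U (π + 1) t := by
        simp only [Matrix.mul_assoc]
      rw [hassoc]
      have hlayer : (layerOp U π)ᴴ * B * layerOp U π = evolveBonds U (layerBonds N π) B := by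
        rw [evolveBonds_eq]
        rfl
      rw [hlayer]
      have hp₀ : (y.val - 1) + 1 = y.val := by omega
      have h1 : EdgeData (rightOf ⟨y.val - 1, by omega⟩) ⟨y.val - 1, by omega⟩ (mMinus U β)
          (evolveBonds U (layerBonds N π) B) :=
        edgeData_evolveBonds_layer_left hU (layerBonds N π)
          (fun p hp => by rw [(mem_layerBonds.mp hp).2, hπ]) (nodup_layerBonds N π) hp₀
          (mem_layerBonds.mpr ⟨by omega, by omega⟩) h
      have h2 := ih (π + 1) ⟨y.val - 1, by omega⟩ r (mMinus U β) _ (by simp only; omega)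
        (by simp only; omega) h1
      rwa [← Function.iterate_succ_apply] at h2

/-- **Properties 1–2 for the left-moving family `ν = −`.** For a traceless `b` at site `y` whose
first layer pairs `(y−1, y)` (parity `π ≡ y + 1`), after `t ≤ y` layers:
`d^{-N} tr[a_z 𝕍† b_y 𝕍] = δ_{z, y−t} · d⁻¹ tr[a M₋^t(b)]`.
[cite: BertiniKosProsen2019, Property 1 eq. (12) (`C_−(x,t) = δ_{x,−t} C_−(−t,t)`) and
Property 2 eq. (17) (`C_−(−t,t) = (1/d) tr[M_−^{2t}(a^β) a^α]`)] -/
theorem brickwork_correlation_left [Nonempty m] {U : Matrix (m × m) (m × m) ℂ}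
    (hU : IsDualUnitary U) {b : Matrix m m ℂ} (hb : b.trace = 0) (π t : ℕ) (y z : Fin N)
    (hπ : π % 2 = (y.val + 1) % 2) (hty : t ≤ y.val) (a : Matrix m m ℂ) :
    ((Fintype.card (Fin N → m) : ℂ))⁻¹ *
        (onSite z a * ((brick U π t)ᴴ * onSite y b * brick U π t)).trace =
      if z.val + t = y.val then ((Fintype.card m : ℂ))⁻¹ * (a * (mMinus U)^[t] b).trace else 0 := by
  have hr : y.val - t < N := by have := y.isLt; omega
  have hdata := edgeData_brick_left hU t π y ⟨y.val - t, hr⟩ b (onSite y b) hπ (by simp only; omega)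
    ((edgeData_onSite hb).mono (by
      intro z hz; rw [Finset.mem_singleton] at hz; rw [mem_rightOf, hz]))
  rw [hdata.correlation z a]
  have hiff : (z = ⟨y.val - t, hr⟩) ↔ z.val + t = y.val := by
    constructor
    · intro e; rw [e]; simp only; omega
    · intro e; exact Fin.ext (by simp only; omega)
  by_cases hz : z.val + t = y.val
  · rw [if_pos (hiff.mpr hz), if_pos hz]
  · rw [if_neg (fun e => hz (hiff.mp e)), if_neg hz]

end BrickworkLeft

end Chain

end DualUnitary

end Literature.MathematicalPhysics.QuantumLattice
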